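import Summits.CriticalPhenomena.CardyFormulaZ2.Theses.CardyBoundaryCoulombGas
import Literature.Probability.Percolation.CornerPercolation
import Literature.Probability.Percolation.LatticeSymmetry
import Literature.Probability.Percolation.RSWLemma
import Literature.Probability.Percolation.InequalitiesProofs
import Literature.Probability.RandomPlanarGeometry.CardyFunctionIncBeta

/-!
# Disproof of `HalfPlaneMarkDensityLaw` — findings (crux stmt-CriticalPhenomena-5661, route CardyBoundaryCoulombGas)

Standing adversary's Lean record (refuter `cdisprove`, generation 1, 2026-08-16).  Prose lives in
docstrings only.  `lean check` rc 0, 0 warnings, 0 sorries, axioms {propext, Classical.choice,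
Quot.sound} at every attach.

The crux, literally (`halfPlaneMarkDensityLaw_iff`): for all reals `a < b < c < x`,
`n · P_{1/2}[E_n(a,b,c,x)] → density a b c x` where, in the lattice half-plane `H = ℤ × ℕ` of bond-`ℤ²`,
`E_n = {A_n ↔ (⌊xn⌋,0) in H} \ {A_n ↔ C_n in H}`, `A_n = [⌊an⌋,⌊bn⌋] × {0}`, `C_n = [⌊cn⌋,⌊xn⌋) × {0}`
("`⌊xn⌋` is the `c`-most boundary vertex of `[⌊cn⌋,∞)` joined to the arc `A_n`"; zero-length open
paths count, so overlapping arcs make a crossing event sure), and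
`density a b c x = (cardyConst/3)·((b−a)(c−b)(c−a))^{1/3}·((x−a)(x−b)(x−c))^{−2/3}`.

## Verdict of generation 1: NO KILL.  Why it resists, in one line: the crux is (half of) half-plane
Cardy for bond-`ℤ²` (§3, open since 1992) plus a local ratio-limit regularity in the position of the
fourth mark whose only non-Cardy failure mode — a lattice-scale oscillation — is excluded structurally
by translation covariance (§5) and numerically by MC (§8); the typed constant is exactly right (§1).

## Findings (index)
* §0 vocabulary + `halfPlaneMarkDensityLaw_iff` (the crux through named pieces, `Iff.rfl`).
* §4 LOAD-BEARING ANALYSIS of the three order hypotheses, junk witnesses: `law_false_without_hab`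
  (`b < a`: empty arc, limit `0 ≠ density ≠ 0` — `rpow` of a negative base is `|·|^{1/3} cos(π/3)`),
  `law_false_without_hbc` (`c < b`: arcs overlap, event empty), `law_false_without_hcx` (`x ∈ [a,b]`:
  event sure, `n·1 → ∞`).  Substantive boundary versions: §7 (`x = c`), and `b = c`/`a = b` are TRUE
  degenerations (both sides `0`; the `a = b` point-mark case needs the half-plane one-arm decay
  `n^{−1/3}`: `n·P ≍ n^{−1/3} → 0 = density`, dimensionally consistent with `Δ^{1/3} ∼ (b−a)^{1/3}`).
* §1 THE CONSTANT IS RIGHT, in Lean: `hasDerivAt_cardy_crossRatio` — `d/dx F(crossRatio ![a,b,c,x]) =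
  density a b c x` (`hasDerivAt_cardyFunction_holds` + chain rule + `rpow_key_identity`); so the RHS is
  `F'(η)∂ₓη` with no free constant (settles the grounder's CONSTANT FLAG / route review's paper check).
* §2 EXACT LATTICE IDENTITY (Russo in the position of the mark, no error term):
  `measure_openCrossing_rowIcc` — `P[A ↔ [k₀,k₀+m]×{0} in S] = Σ_{i≤m} P[E(k₀+i)]` for ANY domain/arc;
  `sum_firstHit_le_one`; `measure_crossing_eq_sum_markEvents` (the crux's events).
* §3 WHY IT RESISTS: `liminf_crossing_ge_cardy` — the crux implies
  `F(η(a,b,c,x)) ≤ liminf_n P_{1/2}[A_n ↔ [⌊cn⌋,⌊xn⌋]×{0} in ℤ×ℕ]` for all `a<b<c<x` (Fatou over the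
  mark position + §2 Riemann-sum bound `lintegral_stepDensity_le` + FTC `integral_density_eq_cardy`);
  real form `eventually_crossing_gt`.  A proof of the crux proves the lower half of half-plane Cardy on
  `ℤ²`; a refutation must break a quantity whose window sums are half-plane crossing probabilities.
  Mass bookkeeping cannot kill the constant: `∫_c^∞ density = F((b−a)/(c−a)) < 1` (room = `P[A_n ↮ [c,∞)]`).
* §5 TRANSLATION COVARIANCE (exact): `measureReal_markEvent_succ_site` —
  `P[E_n(a,b,c; site ⌊xn⌋+1)] = P[E_n(a−1/n,b−1/n,c−1/n; site ⌊xn⌋)]`: the `k`-dependence at fixed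
  arcs IS the dependence on the macroscopic marks at resolution `1/n`; a lattice-scale oscillation would
  be an `O(1)` response to moving an arc endpoint by one vertex (against arm separation).
* §6 STRENGTHENING REFUTED: `not_uniformLaw` — no uniformity in `x` down to `c` (density `∼(x−c)^{−2/3}`
  vs `n·P ≤ n`); only local uniformity on compacts of `(c,∞)` + tightness at the marks can hold.
* §7 BOUNDARY CASE `x = c` IS SUBSTANTIVE: `first_site_heavy` — `n·P[A_n ↔ (2n,0) in ℤ×ℕ] ≥ c_RSW/8`
  for all `n ≥ 1` (square crossing `1/2`, RSW `4:1`, Harris–FKG, translation invariance, Jordan lemma,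
  and the union-bound one-arm estimate `armEvent_prob_ge : P ≥ 1/(2(n+1))`, all from PROVED tree
  facts); hence `not_lawAt_x_eq_c`, `law_false_with_hcx_le`.  Conjecturally the first site has mass
  `≍ n^{−1/3}` (MC §8: `n^{1/3}·P ≈ const`).
* §9 TEMPLATE FOR PROVERS (converse companion of §3): `lawSeq_tendsto_of_cdf_of_ratioRegular` — IF
  the lattice CDF `P[A_n ↔ [⌊cn⌋,⌊yn⌋]×{0}] → F(η(a,b,c,y))` for `y ≥ x` AND the mark events are
  ratio-regular to the right of `⌊xn⌋` (window `δn`, tolerance `ε·P[E(⌊xn⌋)]`), THEN the crux holds at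
  `(a,b,c,x)`.  So crux = half-plane Cardy CDF + a GPS-type ratio-limit statement, nothing else.
* §8 NUMERICS (kit jobs j007812/j007859, `mc_markdensity.py`, attached to the item) and the printed
  ¬Cardy claim (Zhang arXiv:2206.04599 Cor. 2, assessed): docblock at the end of the file.

## For provers / planners (what the adversary learned)
* The statement to prove is naturally split as (i) half-plane Cardy for the arcs `[a,b]`, `[c,y]`,
  locally uniformly in `y` (the CDF), and (ii) a ratio-limit theorem `P[E_n(k+j)]/P[E_n(k)] → 1` for
  `|j| ≤ δn`, `k/n` in compacts of `(c,∞)` — by §5 this is continuity of `P[E_n]` under `O(δ)` moves of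
  the three marks, i.e. a GPS-type coupling statement (arXiv:1008.1378 §§3–5 on `𝕋`), available on `ℤ²`
  as far as RSW/arm-separation go; the identification of the limit then comes for free from (i) via §2–§3
  (no separate computation of the constant is needed: `∫ = CDF` pins it).
* Do not try to prove uniformity on `(c,x)` (§6) nor the law at `x = c` (§7); the first `εn` sites carry
  total mass `→ F(η(c+ε)) = O(ε^{1/3})` (§2–§3), which is the usable tightness statement at the mark.
-/

noncomputable section

namespace Summit.CriticalPhenomena.CardyFormulaZ2.Cruxes.HalfPlaneMarkDensityLaw.Disproof

open Literature.Probability.Percolation Literature.Probability.LatticeModels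
open Literature.Probability.RandomPlanarGeometry
open MeasureTheory Filter Set
open scoped ENNReal NNReal Topology
open Summit.CriticalPhenomena.CardyFormulaZ2.Theses.CardyBoundaryCoulombGas (HalfPlaneMarkDensityLaw)

/-- Cardy's function `F` (the `RandomPlanarGeometry` copy; `Percolation.cardyFunction` agrees by `rfl`). -/
local notation "𝔽" => Literature.Probability.RandomPlanarGeometry.cardyFunction

/-! ## §0 Vocabulary -/

/-- The lattice upper half-plane `ℤ × ℕ ⊂ ℤ²` (boundary row included), as in the crux. [folklore] -/
def halfPlane : Set (Site 2) := {v | 0 ≤ v 1}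

/-- The boundary arc `A_n = {(k,0) : ⌊an⌋ ≤ k ≤ ⌊bn⌋}` of the crux. [folklore] -/
def arcA (a b : ℝ) (n : ℕ) : Set (Site 2) := {v | v 1 = 0 ∧ ⌊a * n⌋ ≤ v 0 ∧ v 0 ≤ ⌊b * n⌋}

/-- The excluded boundary arc `C_n = {(k,0) : ⌊cn⌋ ≤ k < ⌊xn⌋}` of the crux. [folklore] -/
def arcC (c x : ℝ) (n : ℕ) : Set (Site 2) := {v | v 1 = 0 ∧ ⌊c * n⌋ ≤ v 0 ∧ v 0 < ⌊x * n⌋}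

/-- The marked boundary vertex `(⌊xn⌋, 0)`. [folklore] -/
def pt (x : ℝ) (n : ℕ) : Site 2 := ![⌊x * n⌋, 0]

/-- The crux's event `E_n(a,b,c,x)`: `(⌊xn⌋,0)` is joined to `A_n` inside the half-plane and no vertex
of `C_n` is, i.e. `⌊xn⌋` is the `c`-most vertex of `[⌊cn⌋, ∞)` joined to `A_n`. [folklore] -/
def markEvent (a b c x : ℝ) (n : ℕ) : Set (BondConfig (Site 2)) :=
  openCrossing halfPlane (arcA a b n) {pt x n} \ openCrossing halfPlane (arcA a b n) (arcC c x n)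

/-- The claimed limit density `(cardyConst/3)·Δ^{1/3}·((x−a)(x−b)(x−c))^{−2/3}`. [folklore] -/
def density (a b c x : ℝ) : ℝ :=
  cardyConst / 3 * ((b - a) * (c - b) * (c - a)) ^ (1 / 3 : ℝ) * ((x - a) * (x - b) * (x - c)) ^ (-(2 / 3) : ℝ)

/-- Critical bond percolation on `ℤ²`. [folklore] -/
def μ : Measure (BondConfig (Site 2)) := bondPercolation (zdGraph 2) half

/-- `P_{1/2}` is a probability measure. [folklore] -/
instance : IsProbabilityMeasure μ := by unfold μ; infer_instance

/-- The crux's sequence `n ↦ n · P_{1/2}[E_n(a,b,c,x)]`. [folklore] -/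
def lawSeq (a b c x : ℝ) : ℕ → ℝ := fun n ↦ (n : ℝ) * μ.real (markEvent a b c x n)

/-- The crux is literally `∀ a b c x, a < b → b < c → c < x → lawSeq a b c x → density a b c x`. [folklore] -/
theorem halfPlaneMarkDensityLaw_iff :
    HalfPlaneMarkDensityLaw ↔ ∀ a b c x : ℝ, a < b → b < c → c < x →
      Tendsto (lawSeq a b c x) atTop (𝓝 (density a b c x)) := Iff.rfl

/-! ## §4 Load-bearing analysis of the order hypotheses (junk witnesses) -/

/-- First coordinate of the marked vertex. [folklore] -/
@[simp] lemma pt_zero (x : ℝ) (n : ℕ) : pt x n 0 = ⌊x * n⌋ := rfl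

/-- Second coordinate of the marked vertex. [folklore] -/
@[simp] lemma pt_one (x : ℝ) (n : ℕ) : pt x n 1 = 0 := rfl

/-- The marked vertex lies in the half-plane. [folklore] -/
lemma pt_mem_halfPlane (x : ℝ) (n : ℕ) : pt x n ∈ halfPlane := by
  simp [halfPlane]

/-- Reflexivity: a vertex of `S` is joined to itself inside `S`. [folklore] -/
lemma mem_openConnIn_self {S : Set (Site 2)} {v : Site 2} (hv : v ∈ S) (ω : BondConfig (Site 2)) :
    ω ∈ openConnIn S v v :=
  ⟨hv, hv, SimpleGraph.Reachable.refl _⟩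

/-- If the two arcs share a vertex of `S`, the crossing event is sure. [folklore] -/
lemma openCrossing_eq_univ_of_mem {S A B : Set (Site 2)} {v : Site 2} (hS : v ∈ S) (hA : v ∈ A)
    (hB : v ∈ B) : openCrossing S A B = univ :=
  eq_univ_of_forall fun ω ↦ ⟨v, hA, v, hB, mem_openConnIn_self hS ω⟩

/-- An empty source arc gives the impossible event. [folklore] -/
lemma openCrossing_empty_left (S B : Set (Site 2)) : openCrossing S (∅ : Set (Site 2)) B = ∅ := by
  ext ω; simp [openCrossing]

/-- An empty target arc gives the impossible event. [folklore] -/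
lemma openCrossing_empty_right (S A : Set (Site 2)) : openCrossing S A (∅ : Set (Site 2)) = ∅ := by
  ext ω; simp [openCrossing]

/-- The junk value shared by the first two witnesses: `density 1 0 2 3 = density 0 2 1 3 =
(cardyConst/3)·(−2)^{1/3}·6^{−2/3} ≠ 0` (Mathlib's `rpow` of a negative base carries `cos(π/3) = 1/2`). [folklore] -/
lemma junkDensity_ne_zero : cardyConst / 3 * (-2 : ℝ) ^ (1 / 3 : ℝ) * (6 : ℝ) ^ (-(2 / 3) : ℝ) ≠ 0 := by
  have h1 : (0 : ℝ) < cardyConst / 3 := by have := cardyConst_pos; positivity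
  have h2 : (-2 : ℝ) ^ (1 / 3 : ℝ) ≠ 0 := by
    rw [Real.rpow_def_of_neg (by norm_num : (-2 : ℝ) < 0)]
    have hc : Real.cos (1 / 3 * Real.pi) = 1 / 2 := by
      rw [show (1 / 3 : ℝ) * Real.pi = Real.pi / 3 by ring]; exact Real.cos_pi_div_three
    rw [hc]; positivity
  have h3 : (0 : ℝ) < (6 : ℝ) ^ (-(2 / 3) : ℝ) := Real.rpow_pos_of_pos (by norm_num) _
  exact mul_ne_zero (mul_ne_zero h1.ne' h2) h3.ne'

/-- WITNESS 1 (`b < a`): for `a = 1, b = 0, c = 2, x = 3` the arc `A_n` is empty once `n ≥ 1`, so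
`E_n = ∅`, `n·P(E_n) = 0 → 0`, whereas `density 1 0 2 3 ≠ 0`.  Hence `a < b` cannot be dropped
(as a junk guard: it is what makes `A_n` non-empty). [folklore] -/
theorem law_false_without_hab :
    ¬ ∀ a b c x : ℝ, b < c → c < x → Tendsto (lawSeq a b c x) atTop (𝓝 (density a b c x)) := by
  intro h
  have hlaw := h 1 0 2 3 (by norm_num) (by norm_num)
  have hev : ∀ n : ℕ, 1 ≤ n → markEvent 1 0 2 3 n = ∅ := by
    intro n hn
    have hA : arcA 1 0 n = ∅ := by
      ext v
      simp only [arcA, one_mul, Int.floor_natCast, zero_mul, Int.floor_zero, mem_setOf_eq,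
        mem_empty_iff_false, iff_false, not_and, not_le]
      intro _ h1
      have : (1 : ℤ) ≤ n := by exact_mod_cast hn
      omega
    simp [markEvent, hA, openCrossing_empty_left]
  have hzero : Tendsto (fun n : ℕ ↦ (n : ℝ) * μ.real (markEvent 1 0 2 3 n)) atTop (nhds 0) := by
    refine tendsto_const_nhds.congr' ?_
    filter_upwards [eventually_ge_atTop 1] with n hn
    simp [hev n hn]
  have heq : density 1 0 2 3 = 0 := tendsto_nhds_unique hlaw hzero
  refine junkDensity_ne_zero ?_
  have : density 1 0 2 3 = cardyConst / 3 * (-2 : ℝ) ^ (1 / 3 : ℝ) * (6 : ℝ) ^ (-(2 / 3) : ℝ) := by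
    norm_num [density]
  rw [← this, heq]

/-- WITNESS 2 (`c < b`): for `a = 0, b = 2, c = 1, x = 3` the arcs `A_n = [0,2n]` and `C_n = [n,3n)`
share the vertex `(n,0)` once `n ≥ 1`, so `{A_n ↔ C_n}` is sure, `E_n = ∅`, `n·P(E_n) → 0`, whereas
`density 0 2 1 3 ≠ 0`.  (At `b = c` exactly both sides vanish — `Δ = 0` — so `b < c` is needed only to
exclude `c < b`; `b ≤ c` would do.) [folklore] -/
theorem law_false_without_hbc :
    ¬ ∀ a b c x : ℝ, a < b → c < x → Tendsto (lawSeq a b c x) atTop (𝓝 (density a b c x)) := by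
  intro h
  have hlaw := h 0 2 1 3 (by norm_num) (by norm_num)
  have hev : ∀ n : ℕ, 1 ≤ n → markEvent 0 2 1 3 n = ∅ := by
    intro n hn
    have hn' : (1 : ℤ) ≤ n := by exact_mod_cast hn
    set v : Site 2 := ![(n : ℤ), 0] with hv
    have hS : v ∈ halfPlane := by simp [halfPlane, hv]
    have hA : v ∈ arcA 0 2 n := by
      simp only [arcA, zero_mul, Int.floor_zero, mem_setOf_eq, hv, Matrix.cons_val_one,
        Matrix.cons_val_zero, true_and]
      constructor
      · positivity
      · rw [show (2 : ℝ) * n = ((2 * n : ℕ) : ℝ) by push_cast; ring, Int.floor_natCast]; omega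
    have hC : v ∈ arcC 1 3 n := by
      simp only [arcC, one_mul, Int.floor_natCast, mem_setOf_eq, hv, Matrix.cons_val_one,
        Matrix.cons_val_zero, le_refl, true_and]
      rw [show (3 : ℝ) * n = ((3 * n : ℕ) : ℝ) by push_cast; ring, Int.floor_natCast]; omega
    simp [markEvent, openCrossing_eq_univ_of_mem hS hA hC]
  have hzero : Tendsto (fun n : ℕ ↦ (n : ℝ) * μ.real (markEvent 0 2 1 3 n)) atTop (nhds 0) := by
    refine tendsto_const_nhds.congr' ?_
    filter_upwards [eventually_ge_atTop 1] with n hn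
    simp [hev n hn]
  have heq : density 0 2 1 3 = 0 := tendsto_nhds_unique hlaw hzero
  refine junkDensity_ne_zero ?_
  have : density 0 2 1 3 = cardyConst / 3 * (-2 : ℝ) ^ (1 / 3 : ℝ) * (6 : ℝ) ^ (-(2 / 3) : ℝ) := by
    norm_num [density]
  rw [← this, heq]

/-- WITNESS 3 (`x < c`, indeed `x ∈ [a,b]`): for `a = 0, b = 2, c = 3, x = 1` the marked vertex
`(n,0)` lies IN the arc `A_n = [0,2n]`, so `{A_n ↔ (n,0)}` is sure, while `C_n = [3n, n) = ∅`; hence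
`E_n` is the sure event and `n·P(E_n) = n → ∞` converges to no real number.  So `c < x` cannot be
dropped.  (The boundary case `x = c` is substantive, see §6 `lawAt_x_eq_c_diverges`.) [folklore] -/
theorem law_false_without_hcx :
    ¬ ∀ a b c x : ℝ, a < b → b < c → Tendsto (lawSeq a b c x) atTop (𝓝 (density a b c x)) := by
  intro h
  have hlaw := h 0 2 3 1 (by norm_num) (by norm_num)
  have hev : ∀ n : ℕ, markEvent 0 2 3 1 n = univ := by
    intro n
    have hS : pt 1 n ∈ halfPlane := pt_mem_halfPlane 1 n
    have hA : pt 1 n ∈ arcA 0 2 n := by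
      simp only [arcA, zero_mul, Int.floor_zero, mem_setOf_eq, pt_one, pt_zero, one_mul,
        Int.floor_natCast, true_and]
      constructor
      · positivity
      · rw [show (2 : ℝ) * n = ((2 * n : ℕ) : ℝ) by push_cast; ring, Int.floor_natCast]; omega
    have hC : arcC 3 1 n = ∅ := by
      ext v
      simp only [arcC, one_mul, Int.floor_natCast, mem_setOf_eq, mem_empty_iff_false, iff_false,
        not_and, not_lt]
      intro _ h3
      rw [show (3 : ℝ) * n = ((3 * n : ℕ) : ℝ) by push_cast; ring, Int.floor_natCast] at h3; omega
    rw [markEvent, hC, openCrossing_empty_right, sdiff_empty,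
      openCrossing_eq_univ_of_mem hS hA (mem_singleton _)]
  have hid : Tendsto (fun n : ℕ ↦ (n : ℝ) * μ.real (markEvent 0 2 3 1 n)) atTop atTop := by
    have : (fun n : ℕ ↦ (n : ℝ) * μ.real (markEvent 0 2 3 1 n)) = fun n : ℕ ↦ (n : ℝ) := by
      funext n; simp [hev n]
    rw [this]; exact tendsto_natCast_atTop_atTop
  exact hid.not_tendsto (disjoint_nhds_atTop _).symm hlaw


/-! ## §1 The constant: `density a b c x = d/dx F(η(a,b,c,x))` (chain rule + `rpow` algebra)

`η(y) = crossRatio ![a,b,c,y] = (b−a)(y−c)/((c−a)(y−b))`, `1 − η = (c−b)(y−a)/((c−a)(y−b))`,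
`η' = (b−a)(c−b)/((c−a)(y−b)²)`, tree fact `F'(η) = (cardyConst/3)(η(1−η))^{−2/3}`
(`hasDerivAt_cardyFunction_holds`, PROVED); the product collapses to the crux's RHS exactly.  So the
typed constant is right: no free constant, no normalisation slip (the grounder's CONSTANT FLAG and the
route review's paper check, now in Lean). -/

/-- `(t^{1/3})³ = t` for `t ≥ 0`. [folklore] -/
lemma rpow_third_pow_three {t : ℝ} (ht : 0 ≤ t) : (t ^ (1 / 3 : ℝ)) ^ (3 : ℕ) = t := by
  rw [← Real.rpow_natCast, ← Real.rpow_mul ht]; norm_num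

/-- `(m³)^{1/3} = m` for `m ≥ 0`. [folklore] -/
lemma pow_three_rpow_third {m : ℝ} (hm : 0 ≤ m) : (m ^ (3 : ℕ)) ^ (1 / 3 : ℝ) = m := by
  rw [← Real.rpow_natCast, ← Real.rpow_mul hm]; norm_num

/-- `(m³)^{−2/3} = (m²)⁻¹` for `m > 0`. [folklore] -/
lemma pow_three_rpow_neg_two_thirds {m : ℝ} (hm : 0 < m) :
    (m ^ (3 : ℕ)) ^ (-(2 / 3) : ℝ) = (m ^ (2 : ℕ))⁻¹ := by
  rw [← Real.rpow_natCast, ← Real.rpow_mul hm.le,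
    show ((3 : ℕ) : ℝ) * (-(2 / 3) : ℝ) = -(2 : ℝ) by norm_num, Real.rpow_neg hm.le, Real.rpow_two]

/-- Every positive real is a cube of a positive real. [folklore] -/
lemma exists_pos_cube (t : ℝ) (ht : 0 < t) : ∃ m : ℝ, 0 < m ∧ m ^ (3 : ℕ) = t :=
  ⟨t ^ (1 / 3 : ℝ), Real.rpow_pos_of_pos ht _, rpow_third_pow_three ht.le⟩

/-- The `rpow` identity behind the constant, in six INDEPENDENT positive variables
`p = b−a, q = c−b, r = c−a, u = x−a, v = x−b, w = x−c`:
`((pquw)/(rv)²)^{−2/3} · (pq/(rv²)) = (pqr)^{1/3} (uvw)^{−2/3}`. [folklore] -/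
lemma rpow_key_identity {p q r u v w : ℝ} (hp : 0 < p) (hq : 0 < q) (hr : 0 < r) (hu : 0 < u)
    (hv : 0 < v) (hw : 0 < w) :
    (p * q * u * w / (r * v) ^ 2) ^ (-(2 / 3) : ℝ) * (p * q / (r * v ^ 2)) =
      (p * q * r) ^ (1 / 3 : ℝ) * (u * v * w) ^ (-(2 / 3) : ℝ) := by
  obtain ⟨P, hP, rfl⟩ := exists_pos_cube p hp
  obtain ⟨Q, hQ, rfl⟩ := exists_pos_cube q hq
  obtain ⟨R, hR, rfl⟩ := exists_pos_cube r hr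
  obtain ⟨U, hU, rfl⟩ := exists_pos_cube u hu
  obtain ⟨V, hV, rfl⟩ := exists_pos_cube v hv
  obtain ⟨W, hW, rfl⟩ := exists_pos_cube w hw
  have h1 : P ^ 3 * Q ^ 3 * U ^ 3 * W ^ 3 / (R ^ 3 * V ^ 3) ^ 2 = (P * Q * U * W / (R * V) ^ 2) ^ 3 := by
    ring
  have h2 : P ^ 3 * Q ^ 3 * R ^ 3 = (P * Q * R) ^ 3 := by ring
  have h3 : U ^ 3 * V ^ 3 * W ^ 3 = (U * V * W) ^ 3 := by ring
  rw [h1, h2, h3, pow_three_rpow_neg_two_thirds (by positivity), pow_three_rpow_third (by positivity),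
    pow_three_rpow_neg_two_thirds (by positivity)]
  field_simp

/-- The cross-ratio of the crux's four marks in closed form. [folklore] -/
lemma crossRatio_four (a b c y : ℝ) :
    crossRatio ![a, b, c, y] = (a - b) * (c - y) / ((a - c) * (b - y)) := by
  simp [crossRatio]

/-- `η(1−η) = (b−a)(c−b)(x−a)(x−c)/((c−a)(x−b))²` for the crux's marks. [folklore] -/
lemma crossRatio_mul_one_sub {a b c x : ℝ} (hab : a < b) (hbc : b < c) (hcx : c < x) :
    crossRatio ![a, b, c, x] * (1 - crossRatio ![a, b, c, x]) =
      (b - a) * (c - b) * (x - a) * (x - c) / ((c - a) * (x - b)) ^ 2 := by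
  rw [crossRatio_four]
  have h1 : a - c ≠ 0 := (by linarith : a - c < 0).ne
  have h2 : b - x ≠ 0 := (by linarith : b - x < 0).ne
  have h3 : c - a ≠ 0 := (by linarith : 0 < c - a).ne'
  have h4 : x - b ≠ 0 := (by linarith : 0 < x - b).ne'
  field_simp
  ring

/-- For `a < b < c < x` the cross-ratio lies in `(0,1)`. [folklore] -/
lemma crossRatio_four_mem_Ioo {a b c x : ℝ} (hab : a < b) (hbc : b < c) (hcx : c < x) :
    crossRatio ![a, b, c, x] ∈ Ioo (0 : ℝ) 1 := by
  refine crossRatio_mem_Ioo (Or.inl ?_)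
  refine Fin.strictMono_iff_lt_succ.2 fun i ↦ ?_
  fin_cases i <;> simp [hab, hbc, hcx]

/-- The derivative of `y ↦ η(a,b,c,y)` at `x`. [folklore] -/
lemma hasDerivAt_crossRatio_four {a b c x : ℝ} (hab : a < b) (hbc : b < c) (hcx : c < x) :
    HasDerivAt (fun y : ℝ ↦ crossRatio ![a, b, c, y]) ((b - a) * (c - b) / ((c - a) * (x - b) ^ 2)) x := by
  have hfun : (fun y : ℝ ↦ crossRatio ![a, b, c, y]) = fun y ↦ (a - b) * (c - y) / ((a - c) * (b - y)) := by
    funext y; exact crossRatio_four a b c y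
  rw [hfun]
  have hN : HasDerivAt (fun y : ℝ ↦ (a - b) * (c - y)) ((a - b) * (-1)) x :=
    ((hasDerivAt_id x).const_sub c).const_mul (a - b)
  have hD : HasDerivAt (fun y : ℝ ↦ (a - c) * (b - y)) ((a - c) * (-1)) x :=
    ((hasDerivAt_id x).const_sub b).const_mul (a - c)
  have h1 : a - c ≠ 0 := (by linarith : a - c < 0).ne
  have h2 : b - x ≠ 0 := (by linarith : b - x < 0).ne
  have h3 : c - a ≠ 0 := (by linarith : 0 < c - a).ne'
  have h4 : x - b ≠ 0 := (by linarith : 0 < x - b).ne'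
  have hDx : (a - c) * (b - x) ≠ 0 := mul_ne_zero h1 h2
  refine (hN.div hD hDx).congr_deriv ?_
  field_simp
  ring

/-- **The constant is right**: `(cardyConst/3)(η(1−η))^{−2/3} · η'(x) = density a b c x`. [folklore] -/
theorem cardyDeriv_mul_eq_density {a b c x : ℝ} (hab : a < b) (hbc : b < c) (hcx : c < x) :
    cardyConst / 3 * (crossRatio ![a, b, c, x] * (1 - crossRatio ![a, b, c, x])) ^ (-(2 / 3) : ℝ) *
        ((b - a) * (c - b) / ((c - a) * (x - b) ^ 2)) = density a b c x := by
  rw [crossRatio_mul_one_sub hab hbc hcx, density]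
  have key := rpow_key_identity (p := b - a) (q := c - b) (r := c - a) (u := x - a) (v := x - b)
    (w := x - c) (by linarith) (by linarith) (by linarith) (by linarith) (by linarith) (by linarith)
  linear_combination (cardyConst / 3) * key

/-- **§1 main**: `d/dx F(η(a,b,c,x)) = density a b c x` on `x > c` — the crux's RHS is exactly the
`x`-derivative of the half-plane Cardy crossing probability `F(η)` between `[a,b]` and `[c,x]`
(Cardy 1992 eq. (8) for `F'`; chain rule). [cite: CardyJPhysA1992, eq. (8)] -/
theorem hasDerivAt_cardy_crossRatio {a b c x : ℝ} (hab : a < b) (hbc : b < c) (hcx : c < x) :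
    HasDerivAt (fun y : ℝ ↦ 𝔽 (crossRatio ![a, b, c, y])) (density a b c x) x := by
  have hη := hasDerivAt_crossRatio_four hab hbc hcx
  have hF : HasDerivAt 𝔽
      (cardyConst / 3 * (crossRatio ![a, b, c, x] * (1 - crossRatio ![a, b, c, x])) ^ (-(2 / 3) : ℝ))
      (crossRatio ![a, b, c, x]) :=
    hasDerivAt_cardyFunction_holds (crossRatio_four_mem_Ioo hab hbc hcx)
  have h := hF.comp x hη
  rw [← cardyDeriv_mul_eq_density hab hbc hcx]
  exact h

/-- The density is positive on `x > c`. [folklore] -/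
lemma density_pos {a b c x : ℝ} (hab : a < b) (hbc : b < c) (hcx : c < x) : 0 < density a b c x := by
  unfold density
  have h1 := cardyConst_pos
  have h2 : 0 < (b - a) * (c - b) * (c - a) := by
    apply mul_pos (mul_pos _ _) <;> linarith
  have h3 : 0 < (x - a) * (x - b) * (x - c) := by
    apply mul_pos (mul_pos _ _) <;> linarith
  have := Real.rpow_pos_of_pos h2 (1 / 3 : ℝ)
  have := Real.rpow_pos_of_pos h3 (-(2 / 3) : ℝ)
  positivity

/-! ## §2 Exact lattice identities: the mark events partition the crossing event

For ANY domain `S` and source arc `A`: with `B_k = [k₀,k] × {0}` and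
`E(k) = {A ↔ (k,0) in S} \ {A ↔ [k₀,k) × {0} in S}` (the crux's event is `E(⌊xn⌋)` with
`k₀ = ⌊cn⌋`, `markEvent_eq_firstHit`), one has `{A ↔ B_k} = {A ↔ B_{k−1}} ⊔ E(k)`, hence
`P[A ↔ B_{k₀+m}] = Σ_{i ≤ m} P[E(k₀+i)]` (`measure_openCrossing_rowIcc`) and all partial sums are `≤ 1`
(`sum_firstHit_le_one`): the lattice density telescopes EXACTLY to the lattice crossing probability —
Russo's formula in the position of the fourth mark, with no error term. -/

/-- The boundary segment `[k₀,k₁] × {0}`. [folklore] -/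
def rowIcc (k₀ k₁ : ℤ) : Set (Site 2) := {v | v 1 = 0 ∧ k₀ ≤ v 0 ∧ v 0 ≤ k₁}

/-- The boundary segment `[k₀,k₁) × {0}`. [folklore] -/
def rowIco (k₀ k₁ : ℤ) : Set (Site 2) := {v | v 1 = 0 ∧ k₀ ≤ v 0 ∧ v 0 < k₁}

/-- The boundary vertex `(k,0)`. [folklore] -/
def bpt (k : ℤ) : Site 2 := ![k, 0]

/-- `E(k)`: `(k,0)` is the `k₀`-most vertex of `[k₀,∞) × {0}` joined to `A` inside `S`. [folklore] -/
def firstHit (S A : Set (Site 2)) (k₀ k : ℤ) : Set (BondConfig (Site 2)) :=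
  openCrossing S A {bpt k} \ openCrossing S A (rowIco k₀ k)

/-- The crux's event is `firstHit` at `k₀ = ⌊cn⌋`, `k = ⌊xn⌋` (definitional). [folklore] -/
theorem markEvent_eq_firstHit (a b c x : ℝ) (n : ℕ) :
    markEvent a b c x n = firstHit halfPlane (arcA a b n) ⌊c * n⌋ ⌊x * n⌋ := rfl

/-- A site is `(k,0)` iff its coordinates say so. [folklore] -/
lemma site_eq_bpt_iff (v : Site 2) (k : ℤ) : v = bpt k ↔ v 1 = 0 ∧ v 0 = k := by
  constructor
  · rintro rfl; simp [bpt]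
  · rintro ⟨h1, h0⟩
    funext i; fin_cases i <;> simp [bpt, h0, h1]

/-- `[k₀,k) = [k₀,k−1]` on the boundary row. [folklore] -/
lemma rowIco_eq_rowIcc (k₀ k : ℤ) : rowIco k₀ k = rowIcc k₀ (k - 1) := by
  ext v; simp only [rowIco, rowIcc, mem_setOf_eq]; omega

/-- Empty boundary segment. [folklore] -/
lemma rowIcc_eq_empty {k₀ k₁ : ℤ} (h : k₁ < k₀) : rowIcc k₀ k₁ = ∅ := by
  ext v; simp only [rowIcc, mem_setOf_eq, mem_empty_iff_false, iff_false]; omega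

/-- `[k₀,k] = [k₀,k−1] ∪ {k}` on the boundary row. [folklore] -/
lemma rowIcc_eq_union {k₀ k : ℤ} (h : k₀ ≤ k) : rowIcc k₀ k = rowIcc k₀ (k - 1) ∪ {bpt k} := by
  ext v
  simp only [rowIcc, mem_setOf_eq, union_singleton, mem_insert_iff, site_eq_bpt_iff]
  omega

/-- Crossing events are additive in the target arc. [folklore] -/
lemma openCrossing_union_right (S A B B' : Set (Site 2)) :
    openCrossing S A (B ∪ B') = openCrossing S A B ∪ openCrossing S A B' := by
  ext ω
  simp only [mem_openCrossing_iff, mem_union]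
  constructor
  · rintro ⟨x, hx, y, hy | hy, h⟩
    · exact Or.inl ⟨x, hx, y, hy, h⟩
    · exact Or.inr ⟨x, hx, y, hy, h⟩
  · rintro (⟨x, hx, y, hy, h⟩ | ⟨x, hx, y, hy, h⟩)
    · exact ⟨x, hx, y, Or.inl hy, h⟩
    · exact ⟨x, hx, y, Or.inr hy, h⟩

/-- One telescoping step: `{A ↔ B_k} = {A ↔ B_{k−1}} ∪ E(k)`. [folklore] -/
theorem openCrossing_rowIcc_succ (S A : Set (Site 2)) {k₀ k : ℤ} (h : k₀ ≤ k) :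
    openCrossing S A (rowIcc k₀ k) = openCrossing S A (rowIcc k₀ (k - 1)) ∪ firstHit S A k₀ k := by
  rw [rowIcc_eq_union h, openCrossing_union_right, firstHit, rowIco_eq_rowIcc, Set.union_sdiff_self]

/-- … and the two pieces are disjoint. [folklore] -/
theorem disjoint_openCrossing_firstHit (S A : Set (Site 2)) (k₀ k : ℤ) :
    Disjoint (openCrossing S A (rowIcc k₀ (k - 1))) (firstHit S A k₀ k) := by
  rw [firstHit, rowIco_eq_rowIcc]; exact disjoint_sdiff_right

/-- Mark events are measurable (countably many finite open paths). [folklore] -/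
theorem measurableSet_firstHit (S A : Set (Site 2)) (k₀ k : ℤ) : MeasurableSet (firstHit S A k₀ k) :=
  (measurableSet_openCrossing_of_countable _ _ _).diff (measurableSet_openCrossing_of_countable _ _ _)

/-- **§2 main (Russo/telescoping, exact)**: `P[A ↔ [k₀, k₀+m] × {0} in S] = Σ_{i=0}^{m} P[E(k₀+i)]`. [folklore] -/
theorem measure_openCrossing_rowIcc (S A : Set (Site 2)) (k₀ : ℤ) (m : ℕ) :
    μ (openCrossing S A (rowIcc k₀ (k₀ + m))) =
      ∑ i ∈ Finset.range (m + 1), μ (firstHit S A k₀ (k₀ + i)) := by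
  induction m with
  | zero =>
    rw [Finset.sum_range_one, Nat.cast_zero, add_zero, openCrossing_rowIcc_succ S A le_rfl,
      rowIcc_eq_empty (by omega), openCrossing_empty_right, empty_union]
  | succ m ih =>
    have hk : k₀ + ((m + 1 : ℕ) : ℤ) - 1 = k₀ + (m : ℤ) := by push_cast; ring
    rw [Finset.sum_range_succ, ← ih, openCrossing_rowIcc_succ S A (k := k₀ + ((m + 1 : ℕ) : ℤ)) (by omega),
      hk, measure_union (by rw [← hk]; exact disjoint_openCrossing_firstHit S A k₀ _)
        (measurableSet_firstHit S A _ _)]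

/-- Corollary: every partial sum of mark-event probabilities is at most `1`. [folklore] -/
theorem sum_firstHit_le_one (S A : Set (Site 2)) (k₀ : ℤ) (m : ℕ) :
    ∑ i ∈ Finset.range (m + 1), μ (firstHit S A k₀ (k₀ + i)) ≤ 1 := by
  rw [← measure_openCrossing_rowIcc]; exact prob_le_one

/-- Corollary for the crux's own events: for `c ≤ x`,
`P[A_n ↔ [⌊cn⌋,⌊xn⌋] × {0} in H] = Σ_{k=⌊cn⌋}^{⌊xn⌋} P[E_n at lattice point k]` where the `k`-th
term is `markEvent` at any real `y` with `⌊yn⌋ = k` — the lattice crossing probability IS the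
Riemann sum of the lattice density. [folklore] -/
theorem measure_crossing_eq_sum_markEvents (a b c x : ℝ) (n : ℕ) (hcx : c ≤ x) :
    μ (openCrossing halfPlane (arcA a b n) (rowIcc ⌊c * n⌋ ⌊x * n⌋)) =
      ∑ i ∈ Finset.range ((⌊x * n⌋ - ⌊c * n⌋).toNat + 1),
        μ (firstHit halfPlane (arcA a b n) ⌊c * n⌋ (⌊c * n⌋ + i)) := by
  have hle : ⌊c * n⌋ ≤ ⌊x * n⌋ := Int.floor_le_floor (by exact mul_le_mul_of_nonneg_right hcx (Nat.cast_nonneg n))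
  have : ⌊x * n⌋ = ⌊c * n⌋ + ((⌊x * n⌋ - ⌊c * n⌋).toNat : ℕ) := by
    rw [Int.toNat_of_nonneg (by omega)]; ring
  conv_lhs => rw [this]
  exact measure_openCrossing_rowIcc _ _ _ _


/-! ## §3 Why it resists: the crux contains the lower half of half-plane Cardy on bond-`ℤ²`

Fatou over the position `y ∈ (c,x)` of the fourth mark (the crux at `(a,b,c,y)` is exactly the
pointwise limit of the step function `y ↦ n·P[E_n(a,b,c,y)]`), the exact Riemann-sum identity of §2
and the fundamental theorem of calculus with §1 give
`liminf_n P_{1/2}[A_n ↔ [⌊cn⌋,⌊xn⌋] × {0} in ℤ×ℕ] ≥ F(η(a,b,c,x))` (`liminf_crossing_ge_cardy`):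
ANY proof of the crux proves the lower bound of Cardy's formula in the lattice half-plane for every
pair of boundary arcs `[a,b]`, `[c,x]` — open for bond-`ℤ²` since 1992 — and any refutation must exhibit
non-convergence, or a non-Cardy limit, of a critical `ℤ²` boundary quantity whose window sums ARE the
half-plane crossing probabilities.  (The upper bound does not follow from the crux alone: the law of the
`c`-most point carries total mass `F((b−a)/(c−a)) < 1` on `(c,∞)`, the rest sitting on `{A_n ↮ [c,∞)}`,
which the crux does not constrain; the matching `limsup` needs the dual/left-side law.) -/

/-- The lattice density as a step function of the position `y` of the fourth mark. [folklore] -/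
def stepDensity (a b c : ℝ) (n : ℕ) (y : ℝ) : ℝ≥0∞ := (n : ℝ≥0∞) * μ (markEvent a b c y n)

/-- The step function factors through `y ↦ ⌊yn⌋`. [folklore] -/
lemma stepDensity_eq_comp (a b c : ℝ) (n : ℕ) :
    stepDensity a b c n =
      (fun k : ℤ ↦ (n : ℝ≥0∞) * μ (firstHit halfPlane (arcA a b n) ⌊c * n⌋ k)) ∘ fun y : ℝ ↦ ⌊y * n⌋ :=
  rfl

/-- The step function is Borel measurable (it factors through `y ↦ ⌊yn⌋ ∈ ℤ`). [folklore] -/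
lemma measurable_stepDensity (a b c : ℝ) (n : ℕ) : Measurable (stepDensity a b c n) := by
  rw [stepDensity_eq_comp]
  exact (measurable_of_countable _).comp (Int.measurable_floor.comp (measurable_id.mul_const _))

/-- The cell of reals whose `n`-th lattice point is `k`: `{y | ⌊yn⌋ = k} = [k/n, (k+1)/n)`. [folklore] -/
lemma setOf_floor_mul_eq {n : ℕ} (hn : 0 < n) (k : ℤ) :
    {y : ℝ | ⌊y * n⌋ = k} = Ico ((k : ℝ) / n) (((k : ℝ) + 1) / n) := by
  have hn' : (0 : ℝ) < n := by exact_mod_cast hn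
  ext y
  simp only [mem_setOf_eq, Int.floor_eq_iff, mem_Ico]
  rw [div_le_iff₀ hn', lt_div_iff₀ hn']

/-- Each cell has length `1/n`. [folklore] -/
lemma volume_setOf_floor_mul_eq {n : ℕ} (hn : 0 < n) (k : ℤ) :
    volume {y : ℝ | ⌊y * n⌋ = k} = ENNReal.ofReal (1 / n) := by
  rw [setOf_floor_mul_eq hn, Real.volume_Ico]
  congr 1
  have hn' : (n : ℝ) ≠ 0 := by exact_mod_cast hn.ne'
  field_simp
  ring

/-- Cells are measurable. [folklore] -/
lemma measurableSet_setOf_floor_mul_eq (n : ℕ) (k : ℤ) : MeasurableSet {y : ℝ | ⌊y * n⌋ = k} :=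
  (Int.measurable_floor.comp (measurable_id.mul_const _)) (measurableSet_singleton k)

/-- `(n : ℝ≥0∞) · ofReal (1/n) = 1` for `n ≥ 1`. [folklore] -/
lemma natCast_mul_ofReal_one_div {n : ℕ} (hn : 0 < n) : (n : ℝ≥0∞) * ENNReal.ofReal (1 / n) = 1 := by
  have hn' : (0 : ℝ) < n := by exact_mod_cast hn
  rw [one_div, ENNReal.ofReal_inv_of_pos hn', ENNReal.ofReal_natCast]
  exact ENNReal.mul_inv_cancel (by exact_mod_cast hn.ne') (ENNReal.natCast_ne_top n)

/-- **Riemann-sum bound**: `∫_{(c,x)} n·P[E_n(a,b,c,y)] dy ≤ P[A_n ↔ [⌊cn⌋,⌊xn⌋] × {0}]` (`n ≥ 1`):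
the step function is constant `n·P[E(k)]` on each cell `{⌊yn⌋ = k}` of length `1/n`, the cells met by
`(c,x)` have `⌊cn⌋ ≤ k ≤ ⌊xn⌋`, and §2 sums the cell masses to the crossing probability. [folklore] -/
theorem lintegral_stepDensity_le (a b c x : ℝ) {n : ℕ} (hn : 0 < n) (hcx : c ≤ x) :
    ∫⁻ y in Ioo c x, stepDensity a b c n y ≤
      μ (openCrossing halfPlane (arcA a b n) (rowIcc ⌊c * n⌋ ⌊x * n⌋)) := by
  set k₀ : ℤ := ⌊c * n⌋ with hk₀
  set M : ℕ := (⌊x * n⌋ - ⌊c * n⌋).toNat with hM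
  set E : ℕ → Set (BondConfig (Site 2)) := fun i ↦ firstHit halfPlane (arcA a b n) k₀ (k₀ + i) with hE
  set cell : ℕ → Set ℝ := fun i ↦ {y : ℝ | ⌊y * n⌋ = k₀ + i} with hcell
  set g : ℝ → ℝ≥0∞ := fun y ↦ ∑ i ∈ Finset.range (M + 1), (cell i).indicator (fun _ ↦ (n : ℝ≥0∞) * μ (E i)) y
    with hg
  have hmeas_g : Measurable g := by
    refine Finset.measurable_sum _ fun i _ ↦ ?_
    exact measurable_const.indicator (measurableSet_setOf_floor_mul_eq n _)
  have hn0 : (0 : ℝ) ≤ n := Nat.cast_nonneg n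
  -- pointwise domination on (c,x)
  have hdom : ∀ y ∈ Ioo c x, stepDensity a b c n y ≤ g y := by
    intro y hy
    have h1 : k₀ ≤ ⌊y * n⌋ := Int.floor_le_floor (mul_le_mul_of_nonneg_right hy.1.le hn0)
    have h2 : ⌊y * n⌋ ≤ ⌊x * n⌋ := Int.floor_le_floor (mul_le_mul_of_nonneg_right hy.2.le hn0)
    set i : ℕ := (⌊y * n⌋ - k₀).toNat with hi
    have hik : k₀ + (i : ℤ) = ⌊y * n⌋ := by rw [hi, Int.toNat_of_nonneg (by omega)]; ring
    have himem : i ∈ Finset.range (M + 1) := by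
      rw [Finset.mem_range, hi, hM]; omega
    have hyc : y ∈ cell i := by simp [hcell, hik]
    calc stepDensity a b c n y = (cell i).indicator (fun _ ↦ (n : ℝ≥0∞) * μ (E i)) y := by
          rw [indicator_of_mem hyc, stepDensity, markEvent_eq_firstHit, hE]
          simp only [hik]
          rfl
      _ ≤ g y := Finset.single_le_sum (f := fun j ↦ (cell j).indicator (fun _ ↦ (n : ℝ≥0∞) * μ (E j)) y)
          (fun j _ ↦ bot_le) himem
  calc ∫⁻ y in Ioo c x, stepDensity a b c n y ≤ ∫⁻ y in Ioo c x, g y := setLIntegral_mono hmeas_g hdom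
    _ ≤ ∫⁻ y, g y := setLIntegral_le_lintegral _ _
    _ = ∑ i ∈ Finset.range (M + 1), ∫⁻ y, (cell i).indicator (fun _ ↦ (n : ℝ≥0∞) * μ (E i)) y := by
          rw [hg, lintegral_finsetSum]
          exact fun i _ ↦ measurable_const.indicator (measurableSet_setOf_floor_mul_eq n _)
    _ = ∑ i ∈ Finset.range (M + 1), μ (E i) := by
          refine Finset.sum_congr rfl fun i _ ↦ ?_
          rw [lintegral_indicator_const (measurableSet_setOf_floor_mul_eq n _),
            volume_setOf_floor_mul_eq hn, mul_comm (n : ℝ≥0∞) (μ (E i)), mul_assoc,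
            natCast_mul_ofReal_one_div hn, mul_one]
    _ = μ (openCrossing halfPlane (arcA a b n) (rowIcc ⌊c * n⌋ ⌊x * n⌋)) := by
          rw [measure_crossing_eq_sum_markEvents a b c x n hcx]


/-- The crux at `(a,b,c,y)` pins the pointwise limit of the step function at `y`. [folklore] -/
lemma tendsto_stepDensity_of_lawAt {a b c y : ℝ}
    (h : Tendsto (lawSeq a b c y) atTop (𝓝 (density a b c y))) :
    Tendsto (fun n ↦ stepDensity a b c n y) atTop (𝓝 (ENNReal.ofReal (density a b c y))) := by
  have : (fun n : ℕ ↦ stepDensity a b c n y) =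
      fun n : ℕ ↦ ENNReal.ofReal ((n : ℝ) * μ.real (markEvent a b c y n)) := by
    funext n
    rw [ENNReal.ofReal_mul (Nat.cast_nonneg n), ENNReal.ofReal_natCast, measureReal_def,
      ENNReal.ofReal_toReal (measure_ne_top μ _)]
    rfl
  rw [this]
  exact ENNReal.tendsto_ofReal h

/-- `η(a,b,c,y) ∈ [0,1]` for `y ≥ c` (indeed `< 1`). [folklore] -/
lemma crossRatio_four_mem_Icc {a b c y : ℝ} (hab : a < b) (hbc : b < c) (hcy : c ≤ y) :
    crossRatio ![a, b, c, y] ∈ Icc (0 : ℝ) 1 := by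
  rw [crossRatio_four]
  have hd : 0 < (a - c) * (b - y) := mul_pos_of_neg_of_neg (by linarith) (by linarith)
  refine ⟨div_nonneg (mul_nonneg_of_nonpos_of_nonpos (by linarith) (by linarith)) hd.le, ?_⟩
  rw [div_le_one hd]
  nlinarith [mul_nonneg (sub_nonneg.2 hbc.le) (sub_nonneg.2 (by linarith : a ≤ y))]

/-- `y ↦ F(η(a,b,c,y))` is continuous on `[c, x]` (`F` continuous on `[0,1]`, tree fact
`continuousOn_cardyFunction_holds`, PROVED). [folklore] -/
lemma continuousOn_cardy_crossRatio {a b c x : ℝ} (hab : a < b) (hbc : b < c) :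
    ContinuousOn (fun y : ℝ ↦ 𝔽 (crossRatio ![a, b, c, y])) (Icc c x) := by
  have hF : ContinuousOn 𝔽 (Icc 0 1) :=
    Literature.Probability.RandomPlanarGeometry.continuousOn_cardyFunction_holds
  refine hF.comp ?_ fun y hy ↦ crossRatio_four_mem_Icc hab hbc hy.1
  have : (fun y : ℝ ↦ crossRatio ![a, b, c, y]) = fun y ↦ (a - b) * (c - y) / ((a - c) * (b - y)) := by
    funext y; exact crossRatio_four a b c y
  rw [this]
  refine ContinuousOn.div (by fun_prop) (by fun_prop) fun y hy ↦ ?_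
  exact (mul_pos_of_neg_of_neg (by linarith) (by linarith [hy.1])).ne'

/-- The claimed density is integrable on `(c, x]` (derivative of a monotone continuous function). [folklore] -/
lemma integrableOn_density {a b c x : ℝ} (hab : a < b) (hbc : b < c) :
    IntegrableOn (fun y ↦ density a b c y) (Ioc c x) :=
  intervalIntegral.integrableOn_deriv_of_nonneg (continuousOn_cardy_crossRatio hab hbc)
    (fun _ hy ↦ hasDerivAt_cardy_crossRatio hab hbc hy.1) fun _ hy ↦ (density_pos hab hbc hy.1).le

/-- **FTC**: `∫_c^x density a b c y dy = F(η(a,b,c,x))` — the claimed density integrates to the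
half-plane Cardy crossing probability between `[a,b]` and `[c,x]` (this is the content of the route's
support item `PureProductIntegrates`, here in integral form). [cite: CardyJPhysA1992, eq. (8)] -/
theorem integral_density_eq_cardy {a b c x : ℝ} (hab : a < b) (hbc : b < c) (hcx : c < x) :
    ∫ y in c..x, density a b c y = 𝔽 (crossRatio ![a, b, c, x]) := by
  have hcont := continuousOn_cardy_crossRatio (x := x) hab hbc
  have hderiv : ∀ y ∈ Ioo c x,
      HasDerivAt (fun y : ℝ ↦ 𝔽 (crossRatio ![a, b, c, y])) (density a b c y) y :=
    fun y hy ↦ hasDerivAt_cardy_crossRatio hab hbc hy.1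
  have hint : IntervalIntegrable (fun y ↦ density a b c y) volume c x := by
    rw [intervalIntegrable_iff_integrableOn_Ioc_of_le hcx.le]
    exact integrableOn_density hab hbc
  rw [intervalIntegral.integral_eq_sub_of_hasDerivAt_of_le hcx.le hcont hderiv hint]
  have h0 : crossRatio ![a, b, c, c] = 0 := by rw [crossRatio_four]; simp
  simp only [h0, Literature.Probability.RandomPlanarGeometry.cardyFunction_zero, sub_zero]

/-- **§3 main (why the crux resists)**: the crux implies the `liminf` half of Cardy's formula for
bond-`ℤ²` in the lattice half-plane, for every pair of boundary arcs `[a,b]`, `[c,x]`: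
`F(η(a,b,c,x)) ≤ liminf_n P_{1/2}[A_n ↔ [⌊cn⌋,⌊xn⌋] × {0} in ℤ×ℕ]`
(Fatou in the position of the fourth mark + §2 + §1/FTC).  So a proof of the crux is at least a proof
of half of half-plane Cardy on `ℤ²` (open), and a disproof must break a statement whose Cesàro means
are pinned by Cardy. [folklore] -/
theorem liminf_crossing_ge_cardy (hlaw : HalfPlaneMarkDensityLaw) {a b c x : ℝ} (hab : a < b)
    (hbc : b < c) (hcx : c < x) :
    ENNReal.ofReal (𝔽 (crossRatio ![a, b, c, x])) ≤
      liminf (fun n : ℕ ↦ μ (openCrossing halfPlane (arcA a b n) (rowIcc ⌊c * n⌋ ⌊x * n⌋))) atTop := by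
  rw [halfPlaneMarkDensityLaw_iff] at hlaw
  have hlim : ∀ y ∈ Ioo c x,
      liminf (fun n ↦ stepDensity a b c n y) atTop = ENNReal.ofReal (density a b c y) :=
    fun y hy ↦ (tendsto_stepDensity_of_lawAt (hlaw a b c y hab hbc hy.1)).liminf_eq
  have hLHS : ENNReal.ofReal (𝔽 (crossRatio ![a, b, c, x])) =
      ∫⁻ y in Ioo c x, ENNReal.ofReal (density a b c y) := by
    rw [← integral_density_eq_cardy hab hbc hcx, intervalIntegral.integral_of_le hcx.le,
      ofReal_integral_eq_lintegral_ofReal (integrableOn_density hab hbc)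
        (ae_restrict_of_forall_mem measurableSet_Ioc fun y hy ↦ (density_pos hab hbc hy.1).le),
      setLIntegral_congr Ioo_ae_eq_Ioc]
  rw [hLHS]
  calc ∫⁻ y in Ioo c x, ENNReal.ofReal (density a b c y)
      = ∫⁻ y in Ioo c x, liminf (fun n ↦ stepDensity a b c n y) atTop :=
        setLIntegral_congr_fun measurableSet_Ioo fun y hy ↦ (hlim y hy).symm
    _ ≤ liminf (fun n ↦ ∫⁻ y in Ioo c x, stepDensity a b c n y) atTop :=
        lintegral_liminf_le' fun n ↦ (measurable_stepDensity a b c n).aemeasurable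
    _ ≤ liminf (fun n : ℕ ↦ μ (openCrossing halfPlane (arcA a b n) (rowIcc ⌊c * n⌋ ⌊x * n⌋))) atTop := by
        refine liminf_le_liminf ?_
        filter_upwards [eventually_gt_atTop 0] with n hn
        exact lintegral_stepDensity_le a b c x hn hcx.le

/-- `F(η) > 0` for `η ∈ (0,1)` (strict monotonicity and `F(0) = 0`, tree facts PROVED). [folklore] -/
lemma cardyFunction_pos_of_mem_Ioo {η : ℝ} (hη : η ∈ Ioo (0 : ℝ) 1) : 0 < 𝔽 η := by
  have h := Literature.Probability.RandomPlanarGeometry.strictMonoOn_cardyFunction_holds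
    (left_mem_Icc.2 zero_le_one) ⟨hη.1.le, hη.2.le⟩ hη.1
  rwa [Literature.Probability.RandomPlanarGeometry.cardyFunction_zero] at h

/-- Real-valued reading of §3: for every `ε > 0`, eventually
`P_{1/2}[A_n ↔ [⌊cn⌋,⌊xn⌋] × {0} in ℤ×ℕ] > F(η(a,b,c,x)) − ε`. [folklore] -/
theorem eventually_crossing_gt (hlaw : HalfPlaneMarkDensityLaw) {a b c x : ℝ} (hab : a < b)
    (hbc : b < c) (hcx : c < x) {ε : ℝ} (hε : 0 < ε) :
    ∀ᶠ n : ℕ in atTop, 𝔽 (crossRatio ![a, b, c, x]) - ε <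
      μ.real (openCrossing halfPlane (arcA a b n) (rowIcc ⌊c * n⌋ ⌊x * n⌋)) := by
  have hF : 0 < 𝔽 (crossRatio ![a, b, c, x]) :=
    cardyFunction_pos_of_mem_Ioo (crossRatio_four_mem_Ioo hab hbc hcx)
  have h := liminf_crossing_ge_cardy hlaw hab hbc hcx
  have hlt : ENNReal.ofReal (𝔽 (crossRatio ![a, b, c, x]) - ε) <
      liminf (fun n : ℕ ↦ μ (openCrossing halfPlane (arcA a b n) (rowIcc ⌊c * n⌋ ⌊x * n⌋))) atTop :=
    lt_of_lt_of_le ((ENNReal.ofReal_lt_ofReal_iff hF).2 (by linarith)) h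
  filter_upwards [eventually_lt_of_lt_liminf hlt] with n hn
  rw [measureReal_def]
  calc 𝔽 (crossRatio ![a, b, c, x]) - ε ≤ (ENNReal.ofReal (𝔽 (crossRatio ![a, b, c, x]) - ε)).toReal := by
        rw [ENNReal.toReal_ofReal']; exact le_max_left _ _
    _ < (μ (openCrossing halfPlane (arcA a b n) (rowIcc ⌊c * n⌋ ⌊x * n⌋))).toReal :=
        ENNReal.toReal_strict_mono (measure_ne_top μ _) hn


/-! ## §5 Translation covariance: the next site with the same arcs = the same site with the arcs moved by `−1/n`

The only conceivable failure mode of the crux that does not touch Cardy's formula is a LATTICE-SCALE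
OSCILLATION of `k ↦ P[E_n(k)]` at fixed arcs (the planner's kill criterion (d)).  The exact identity
`measureReal_markEvent_succ_site` shows what such an oscillation would have to be: since the lattice
half-plane is invariant under the horizontal unit shift, `P[E_n at site ⌊xn⌋+1; arcs a,b,c] =
P[E_n at site ⌊xn⌋; arcs a−1/n, b−1/n, c−1/n]`, i.e. the `k`-dependence at fixed arcs IS the
dependence on the macroscopic marks at resolution `1/n`.  An `O(1)` relative oscillation in `k` would
be an `O(1)` sensitivity of `n·P[E_n]` to moving an arc endpoint by ONE vertex, against RSW arm
separation (moving an endpoint of `A_n` or `C_n` by one vertex changes the event only on an extra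
boundary arm issued from that vertex, relative cost `n^{-1/3+o(1)}` heuristically; universally
`≤ n^{-δ}` on `ℤ²`).  MC (§7) sees no parity effect at the `10⁻³` level. -/

/-- The horizontal unit vector `e₀ = (1,0)`. [folklore] -/
def e0 : Site 2 := ![1, 0]

/-- First coordinate of `e₀`. [folklore] -/
@[simp] lemma e0_zero : e0 0 = 1 := rfl

/-- Second coordinate of `e₀`. [folklore] -/
@[simp] lemma e0_one : e0 1 = 0 := rfl

/-- The unit shift of a set of sites as a preimage. [folklore] -/
lemma image_shift_eq_preimage (T : Set (Site 2)) : (· + e0) '' T = {v | v - e0 ∈ T} := by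
  ext v
  simp only [mem_image, mem_setOf_eq]
  constructor
  · rintro ⟨w, hw, rfl⟩; simpa using hw
  · intro hv; exact ⟨v - e0, hv, by simp⟩

/-- The lattice half-plane is invariant under the horizontal unit shift. [folklore] -/
@[simp] lemma image_shift_halfPlane : (· + e0) '' halfPlane = halfPlane := by
  rw [image_shift_eq_preimage]; ext v; simp [halfPlane]

/-- Shifted boundary segments. [folklore] -/
@[simp] lemma image_shift_rowIcc (k₀ k : ℤ) : (· + e0) '' rowIcc k₀ k = rowIcc (k₀ + 1) (k + 1) := by
  rw [image_shift_eq_preimage]; ext v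
  simp only [rowIcc, mem_setOf_eq, Pi.sub_apply, e0_one, sub_zero, e0_zero]
  omega

/-- Shifting the arc `A_n` by one vertex = moving both marks by `1/n`. [folklore] -/
lemma image_shift_arcA (a b : ℝ) {n : ℕ} (hn : 0 < n) :
    (· + e0) '' arcA (a - 1 / n) (b - 1 / n) n = arcA a b n := by
  have hn' : (n : ℝ) ≠ 0 := by exact_mod_cast hn.ne'
  have ha : ⌊(a - 1 / n) * n⌋ = ⌊a * n⌋ - 1 := by
    rw [show (a - 1 / n) * n = a * n - 1 by field_simp, Int.floor_sub_one]
  have hb : ⌊(b - 1 / n) * n⌋ = ⌊b * n⌋ - 1 := by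
    rw [show (b - 1 / n) * n = b * n - 1 by field_simp, Int.floor_sub_one]
  rw [image_shift_eq_preimage]; ext v
  simp only [arcA, mem_setOf_eq, Pi.sub_apply, e0_one, sub_zero, e0_zero, ha, hb]
  omega

/-- Real-valued one-step telescoping (§2): `P[E(k)] = P[A ↔ B_k] − P[A ↔ B_{k−1}]`. [folklore] -/
theorem measureReal_firstHit_eq_sub (S A : Set (Site 2)) {k₀ k : ℤ} (hk : k₀ ≤ k) :
    μ.real (firstHit S A k₀ k) =
      μ.real (openCrossing S A (rowIcc k₀ k)) - μ.real (openCrossing S A (rowIcc k₀ (k - 1))) := by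
  rw [openCrossing_rowIcc_succ S A hk, measureReal_union (disjoint_openCrossing_firstHit S A k₀ k)
    (measurableSet_firstHit S A k₀ k)]
  ring

/-- Shifting the source arc and the target window by `e₀` does not change `P[E(k)]`
(translation invariance of `P_{1/2}` on `ℤ²`, tree `real_openCrossing_shift`, and invariance of the
lattice half-plane under horizontal shifts). [folklore] -/
theorem measureReal_firstHit_shift (A : Set (Site 2)) {k₀ k : ℤ} (hk : k₀ ≤ k) :
    μ.real (firstHit halfPlane ((· + e0) '' A) (k₀ + 1) (k + 1)) = μ.real (firstHit halfPlane A k₀ k) := by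
  rw [measureReal_firstHit_eq_sub _ _ (by omega : k₀ + 1 ≤ k + 1), measureReal_firstHit_eq_sub _ _ hk,
    show k + 1 - 1 = (k - 1) + 1 by ring, ← image_shift_rowIcc k₀ k, ← image_shift_rowIcc k₀ (k - 1)]
  conv_lhs => rw [← image_shift_halfPlane]
  unfold μ
  rw [real_openCrossing_shift, real_openCrossing_shift]

/-- **§5 main**: `P[E_n(a,b,c; site ⌊xn⌋+1)] = P[E_n(a−1/n, b−1/n, c−1/n; site ⌊xn⌋)]` — the next
lattice site with the same arcs is the same site with all three marks moved by `−1/n`. [folklore] -/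
theorem measureReal_markEvent_succ_site (a b c x : ℝ) {n : ℕ} (hn : 0 < n) (hcx : c ≤ x) :
    μ.real (markEvent a b c (x + 1 / n) n) = μ.real (markEvent (a - 1 / n) (b - 1 / n) (c - 1 / n) x n) := by
  have hn' : (n : ℝ) ≠ 0 := by exact_mod_cast hn.ne'
  have hx : ⌊(x + 1 / n) * n⌋ = ⌊x * n⌋ + 1 := by
    rw [show (x + 1 / n) * n = x * n + 1 by field_simp, Int.floor_add_one]
  have hc : ⌊(c - 1 / n) * n⌋ = ⌊c * n⌋ - 1 := by
    rw [show (c - 1 / n) * n = c * n - 1 by field_simp, Int.floor_sub_one]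
  have hle : ⌊c * n⌋ ≤ ⌊x * n⌋ :=
    Int.floor_le_floor (mul_le_mul_of_nonneg_right hcx (Nat.cast_nonneg n))
  have h := measureReal_firstHit_shift (arcA (a - 1 / n) (b - 1 / n) n) (k₀ := ⌊c * n⌋ - 1)
    (k := ⌊x * n⌋) (by omega)
  rw [show ⌊c * (n : ℝ)⌋ - 1 + 1 = ⌊c * (n : ℝ)⌋ by ring] at h
  rw [markEvent_eq_firstHit, markEvent_eq_firstHit, hx, hc, ← image_shift_arcA a b hn]
  exact h


/-! ## §6 A natural strengthening refuted: no uniformity down to `x = c`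

The claimed density blows up like `(x−c)^{−2/3}` at the left end while `n·P[E_n] ≤ n` trivially, so
the convergence in the crux can be at best LOCALLY uniform on compacts of `(c,∞)`; the version
uniform on `(c,x)` (the uniform law) is false for every `n` (`not_uniformLaw`).  The planner's glue
`DensityIntegration` therefore needs local uniformity on compacts PLUS a separate tightness estimate at
the marks (the lattice mass of the first `εn` sites is `P[A_n ↔ [⌊cn⌋,⌊(c+ε)n⌋]] → F(η(c+ε)) = O(ε^{1/3})`
by §2–§3, which is the form in which the singularity is integrable). -/

/-- Lower bound for the density near `c` in the instance `(0,1,2)`: for `0 < s ≤ 1/2` and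
`y = 2 + s³/6`, `density 0 1 2 y ≥ (cardyConst/3)·s⁻²`. [folklore] -/
lemma density_lower_bound {s : ℝ} (hs : 0 < s) (hs1 : s ≤ 1 / 2) :
    cardyConst / 3 * (s ^ 2)⁻¹ ≤ density 0 1 2 (2 + s ^ 3 / 6) := by
  set y : ℝ := 2 + s ^ 3 / 6 with hy
  have hs3 : s ^ 3 ≤ 1 / 8 := by nlinarith [pow_le_pow_left₀ hs.le hs1 3]
  have hy2 : 0 < y - 2 := by have := pow_pos hs 3; rw [hy]; linarith
  have hy3 : y < 3 := by rw [hy]; nlinarith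
  have hK : 0 < cardyConst / 3 := by have := cardyConst_pos; positivity
  -- density 0 1 2 y = K * 2^{1/3} * (y(y-1)(y-2))^{-2/3}
  have hdens : density 0 1 2 y = cardyConst / 3 * (2 : ℝ) ^ (1 / 3 : ℝ) *
      (y * (y - 1) * (y - 2)) ^ (-(2 / 3) : ℝ) := by
    simp only [density]; norm_num
  rw [hdens]
  have h2 : (1 : ℝ) ≤ (2 : ℝ) ^ (1 / 3 : ℝ) := Real.one_le_rpow (by norm_num) (by norm_num)
  -- monotonicity: y(y-1)(y-2) ≤ 6 (y-2) = s^3, exponent negative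
  have hprod_pos : 0 < y * (y - 1) * (y - 2) := by
    have : 0 < y := by linarith
    have : 0 < y - 1 := by linarith
    positivity
  have hprod_le : y * (y - 1) * (y - 2) ≤ s ^ 3 := by
    have h6 : y * (y - 1) ≤ 6 := by nlinarith
    calc y * (y - 1) * (y - 2) ≤ 6 * (y - 2) := by nlinarith
      _ = s ^ 3 := by rw [hy]; ring
  have hmono : (s ^ 3) ^ (-(2 / 3) : ℝ) ≤ (y * (y - 1) * (y - 2)) ^ (-(2 / 3) : ℝ) :=
    Real.rpow_le_rpow_of_nonpos hprod_pos hprod_le (by norm_num)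
  rw [pow_three_rpow_neg_two_thirds hs] at hmono
  calc cardyConst / 3 * (s ^ 2)⁻¹ = cardyConst / 3 * 1 * (s ^ 2)⁻¹ := by ring
    _ ≤ cardyConst / 3 * (2 : ℝ) ^ (1 / 3 : ℝ) * (y * (y - 1) * (y - 2)) ^ (-(2 / 3) : ℝ) := by
        gcongr

/-- **§6 main**: the uniform-on-`(c,x)` strengthening of the crux is FALSE (instance `a,b,c,x =
0,1,2,3`: at the stage `N` where the uniform distance drops below `1`, the point `y = 2 + s³/6` with
`s = min(1/2, K/(N+1))`, `K = cardyConst/3`, has `density ≥ 2(N+1) > N·P + 1`). [folklore] -/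
theorem not_uniformLaw : ¬ ∀ a b c x : ℝ, a < b → b < c → c < x →
    TendstoUniformlyOn (fun (n : ℕ) (y : ℝ) ↦ (n : ℝ) * μ.real (markEvent a b c y n))
      (fun y ↦ density a b c y) atTop (Ioo c x) := by
  intro h
  have hu := h 0 1 2 3 (by norm_num) (by norm_num) (by norm_num)
  rw [Metric.tendstoUniformlyOn_iff] at hu
  obtain ⟨N, hN⟩ := (hu 1 one_pos).exists_forall_of_atTop
  have hK : 0 < cardyConst / 3 := by have := cardyConst_pos; positivity
  set s : ℝ := min (1 / 2) (cardyConst / 3 / (N + 1)) with hs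
  have hs0 : 0 < s := by rw [hs]; positivity
  have hs1 : s ≤ 1 / 2 := min_le_left _ _
  have hs2 : s ≤ cardyConst / 3 / (N + 1) := min_le_right _ _
  set y : ℝ := 2 + s ^ 3 / 6 with hy
  have hs3 : s ^ 3 ≤ 1 / 8 := by nlinarith [pow_le_pow_left₀ hs0.le hs1 3]
  have hymem : y ∈ Ioo (2 : ℝ) 3 :=
    ⟨by have := pow_pos hs0 3; rw [hy]; linarith, by rw [hy]; nlinarith⟩
  have hNy := hN N le_rfl y hymem
  rw [Real.dist_eq, abs_sub_lt_iff] at hNy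
  have hP : (N : ℝ) * μ.real (markEvent 0 1 2 y N) ≤ N := by
    have : μ.real (markEvent 0 1 2 y N) ≤ 1 := measureReal_le_one
    have hN0 : (0 : ℝ) ≤ N := Nat.cast_nonneg N
    nlinarith
  have hlow := density_lower_bound hs0 hs1
  -- K / s² ≥ 2 (N+1): from s ≤ K/(N+1) and s ≤ 1/2 we get s² ≤ (1/2) K/(N+1)
  have hs_sq : s ^ 2 ≤ 1 / 2 * (cardyConst / 3 / (N + 1)) := by
    rw [pow_two]; exact mul_le_mul hs1 hs2 hs0.le (by norm_num)
  have hbig : 2 * ((N : ℝ) + 1) ≤ cardyConst / 3 * (s ^ 2)⁻¹ := by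
    rw [← div_eq_mul_inv, le_div_iff₀ (by positivity)]
    have hN1 : (0 : ℝ) < N + 1 := by positivity
    calc 2 * ((N : ℝ) + 1) * s ^ 2 ≤ 2 * ((N : ℝ) + 1) * (1 / 2 * (cardyConst / 3 / (N + 1))) := by
          gcongr
      _ = cardyConst / 3 := by field_simp
  linarith [hNy.1]


/-! ## §7 The boundary case `x = c` is substantive: the first site is anomalously heavy (RSW)

At `x = c` the excluded arc `C_n` is empty and `E_n = {A_n ↔ (⌊cn⌋,0)}`; the crux's RHS is the
junk value `0` (`0^{−2/3} = 0`), but `n·P[A_n ↔ (⌊cn⌋,0)]` is bounded BELOW (`first_site_heavy`,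
instance `a,b,c = 0,1,2`: `≥ c_RSW/8`), so the law at `(0,1,2,2)` is false (`not_lawAt_x_eq_c`): the strict
inequality `c < x` is load-bearing for a percolation reason, not only as a junk guard.  Conjecturally
`P[A_n ↔ (⌊cn⌋,0)] ≍ n^{−1/3}` (half-plane one-arm exponent), i.e. the first site carries `n^{2/3}`
times the mass of a bulk site — the lattice face of the `(x−c)^{−2/3}` singularity; MC §8.
Ingredients (all PROVED tree facts): square crossing `≥ 1/2` (`crossingProb_half_succ_self_holds`),
RSW for `4:1` rectangles (`rsw_lowerBound_holds`), Harris–FKG (`harris_fkg_holds`), translation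
invariance (`real_openCrossing_shift`), the rectangle-crossing Jordan lemma
(`exists_mem_support_of_crossing`), plus the union-bound half-plane one-arm estimate
`P[(j,0) ↔ height n inside [j−n,j+n]×[0,n]] ≥ 1/(2(n+1))` (`armEvent_prob_ge`). -/

/-- The shift placing the `2n × n` box `[0,2n]×[0,n]` at `[j−n, j+n]×[0,n]`. [folklore] -/
def vshift (j : ℤ) (n : ℕ) : Site 2 := ![j - n, 0]

/-- First coordinate of `vshift`. [folklore] -/
@[simp] lemma vshift_zero (j : ℤ) (n : ℕ) : vshift j n 0 = j - n := rfl

/-- Second coordinate of `vshift`. [folklore] -/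
@[simp] lemma vshift_one (j : ℤ) (n : ℕ) : vshift j n 1 = 0 := rfl

/-- The half-plane one-arm event at the reference position: `(n,0)` is joined to the top side of
`[0,2n]×[0,n]` inside that box. [folklore] -/
def armEvent (n : ℕ) : Set (BondConfig (Site 2)) :=
  openCrossing ↑(rectangle (2 * n) n) {bpt n} ↑(topSide (2 * n) n)

/-- The same event around the boundary point `(j,0)`: box `[j−n,j+n]×[0,n]`. [folklore] -/
def armEventAt (j : ℤ) (n : ℕ) : Set (BondConfig (Site 2)) :=
  openCrossing ((· + vshift j n) '' ↑(rectangle (2 * n) n)) ((· + vshift j n) '' {bpt n})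
    ((· + vshift j n) '' ↑(topSide (2 * n) n))

/-- The shift moves the reference point `(n,0)` to `(j,0)`. [folklore] -/
lemma image_vshift_singleton (j : ℤ) (n : ℕ) : (· + vshift j n) '' {bpt n} = {bpt j} := by
  rw [image_singleton]
  congr 1
  funext i; fin_cases i <;> simp [bpt, vshift]

/-- Translation invariance: all `armEventAt j n` have the probability of `armEvent n`. [folklore] -/
lemma measureReal_armEventAt (j : ℤ) (n : ℕ) : μ.real (armEventAt j n) = μ.real (armEvent n) :=
  real_openCrossing_shift half _ _ _ _

/-- A top–bottom crossing of the square `[0,n]²` starts at some `(j,0)`, `0 ≤ j ≤ n`, and is then an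
arm from `(j,0)` to height `n` inside `[j−n,j+n]×[0,n]`. [folklore] -/
lemma tbCrossing_subset_iUnion (n : ℕ) :
    tbCrossing n n ⊆ ⋃ j ∈ Finset.range (n + 1), armEventAt (j : ℤ) n := by
  rintro ω ⟨b, hb, t, ht, hbt⟩
  simp only [Finset.mem_coe, bottomSide, topSide, Finset.mem_filter, mem_rectangle_iff] at hb ht
  obtain ⟨j, hjn, hbj⟩ : ∃ j : ℕ, j ≤ n ∧ b 0 = j := ⟨(b 0).toNat, by omega, by omega⟩
  simp only [mem_iUnion, Finset.mem_range, exists_prop]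
  refine ⟨j, by omega, b, ?_, t, ?_, openConnIn_mono ?_ _ _ hbt⟩
  · rw [image_vshift_singleton, mem_singleton_iff, site_eq_bpt_iff]; exact ⟨hb.2, hbj⟩
  · rw [mem_image_add_topSide]; simp only [vshift_zero, vshift_one]; push_cast; omega
  · intro z hz
    rw [Finset.mem_coe, mem_rectangle_iff] at hz
    rw [mem_image_add_rectangle]; simp only [vshift_zero, vshift_one]; push_cast; omega

/-- **Half-plane one-arm lower bound by the union bound**: `P[armEvent n] ≥ 1/(2(n+1))`, since the
`n+1` translates cover the top–bottom crossing of the square, of probability `≥ 1/2`. [folklore] -/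
theorem armEvent_prob_ge (n : ℕ) : 1 / (2 * ((n : ℝ) + 1)) ≤ μ.real (armEvent n) := by
  have h1 : (1 : ℝ) / 2 ≤ μ.real (tbCrossing n n) := by
    have h := real_tbCrossing half n n
    rw [show bondPercolation (zdGraph 2) half = μ from rfl] at h
    rw [h]; exact half_le_crossingProb_self crossingProb_half_succ_self_holds n
  have h2 : μ.real (tbCrossing n n) ≤ ∑ j ∈ Finset.range (n + 1), μ.real (armEventAt (j : ℤ) n) :=
    (measureReal_mono (tbCrossing_subset_iUnion n) (measure_ne_top μ _)).trans
      (measureReal_biUnion_finset_le _ _)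
  have h3 : ∑ j ∈ Finset.range (n + 1), μ.real (armEventAt (j : ℤ) n) = ((n : ℝ) + 1) * μ.real (armEvent n) := by
    simp only [measureReal_armEventAt, Finset.sum_const, Finset.card_range, nsmul_eq_mul]
    push_cast; ring
  rw [h3] at h2
  rw [div_le_iff₀ (by positivity)]
  nlinarith [h1.trans h2]

/-- The marked vertex of the instance `x = 2` is `(2n,0)`. [folklore] -/
lemma pt_two (n : ℕ) : pt 2 n = bpt (2 * (n : ℤ)) := by
  unfold pt bpt
  rw [show (2 : ℝ) * (n : ℝ) = ((2 * (n : ℤ) : ℤ) : ℝ) by push_cast; ring, Int.floor_intCast]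

/-- At `x = c = 2` the crux's event is `{A_n ↔ (2n,0) in H}`. [folklore] -/
lemma markEvent_two (n : ℕ) : markEvent 0 1 2 2 n = openCrossing halfPlane (arcA 0 1 n) {bpt (2 * (n : ℤ))} := by
  have hC : arcC 2 2 n = ∅ := by
    ext v; simp only [arcC, mem_setOf_eq, mem_empty_iff_false, iff_false]; omega
  rw [markEvent, hC, openCrossing_empty_right, sdiff_empty, pt_two]

/-- **Deterministic gluing**: a vertical crossing of `[0,n]²`, a horizontal crossing of
`[0,3n]×[0,n]` and an arm from `(2n,0)` to height `n` inside `[n,3n]×[0,n]` together join `(2n,0)`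
to the bottom side `[0,n]×{0} = A_n` inside the half-plane (two applications of the
rectangle-crossing Jordan lemma). [folklore] -/
theorem glue_to_point {n : ℕ} {ω : BondConfig (Site 2)} (hω : ω ⊆ (zdGraph 2).edgeSet)
    (hV : ω ∈ tbCrossing n n) (hH : ω ∈ lrCrossing (3 * n) n) (hA : ω ∈ armEventAt (2 * (n : ℤ)) n) :
    ω ∈ openCrossing halfPlane (arcA 0 1 n) {bpt (2 * (n : ℤ))} := by
  classical
  set Big : Set (Site 2) := ↑(rectangle (3 * n) n) with hBig
  have hmemBig : ∀ z : Site 2, z ∈ Big ↔ 0 ≤ z 0 ∧ z 0 ≤ 3 * (n : ℤ) ∧ 0 ≤ z 1 ∧ z 1 ≤ n := by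
    intro z; rw [hBig, Finset.mem_coe, mem_rectangle_iff]; push_cast; exact Iff.rfl
  have hBigH : Big ⊆ halfPlane := fun z hz ↦ by rw [hmemBig] at hz; exact hz.2.2.1
  have hSqH : (↑(rectangle n n) : Set (Site 2)) ⊆ halfPlane := fun z hz ↦ by
    rw [Finset.mem_coe, mem_rectangle_iff] at hz; exact hz.2.2.1
  have hArH : (· + vshift (2 * (n : ℤ)) n) '' (↑(rectangle (2 * n) n) : Set (Site 2)) ⊆ halfPlane := by
    intro z hz; rw [mem_image_add_rectangle] at hz; simp only [vshift_one] at hz; exact hz.2.2.1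
  -- the horizontal crossing
  obtain ⟨x, hx, y, hy, hxy⟩ := hH
  simp only [Finset.mem_coe, leftSide, rightSide, Finset.mem_filter, mem_rectangle_iff] at hx hy
  push_cast at hx hy
  -- its part before the first visit to the column `n`, inside the square
  obtain ⟨z₁, hz₁0, hxz₁⟩ := exists_openConnIn_column hω (n : ℤ) (by rw [hx.2]; positivity)
    (by rw [hy.2]; omega) hxy
  obtain ⟨P₁, hP₁S, hP₁ω⟩ := exists_walk_of_mem_openConnIn hω hxz₁
  have hP₁box : ∀ w ∈ P₁.support, (0 : ℤ) ≤ w 0 ∧ w 0 ≤ n ∧ 0 ≤ w 1 ∧ w 1 ≤ n := by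
    intro w hw
    have h := hP₁S w hw
    rw [mem_inter_iff, hmemBig, mem_setOf_eq] at h
    omega
  -- the vertical crossing of the square, from `b₁ ∈ A_n`
  obtain ⟨b₁, hb₁, t₁, ht₁, hbt₁⟩ := hV
  simp only [Finset.mem_coe, bottomSide, topSide, Finset.mem_filter, mem_rectangle_iff] at hb₁ ht₁
  obtain ⟨Q₁, hQ₁S, hQ₁ω⟩ := exists_walk_of_mem_openConnIn hω hbt₁
  have hQ₁box : ∀ w ∈ Q₁.support, (0 : ℤ) ≤ w 0 ∧ w 0 ≤ n ∧ 0 ≤ w 1 ∧ w 1 ≤ n := by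
    intro w hw
    have h := hQ₁S w hw
    rw [Finset.mem_coe, mem_rectangle_iff] at h
    omega
  obtain ⟨w₁, hw₁P, hw₁Q⟩ := exists_mem_support_of_crossing (L := 0) (R := n) (B := 0) (T := n)
    P₁ Q₁ hP₁box hQ₁box hx.2 hz₁0 hb₁.2 ht₁.2
  -- the part of the horizontal crossing after its last visit to the column `n`
  have hyx : ω ∈ openConnIn Big y x := by rw [openConnIn_comm]; exact hxy
  obtain ⟨z₂, hz₂0, hyz₂⟩ := exists_openConnIn_column_ge hω (n : ℤ) (by rw [hy.2]; omega)
    (by rw [hx.2]; positivity) hyx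
  have hz₂y : ω ∈ openConnIn (Big ∩ {z | (n : ℤ) ≤ z 0}) z₂ y := by rw [openConnIn_comm]; exact hyz₂
  obtain ⟨P₂, hP₂S, hP₂ω⟩ := exists_walk_of_mem_openConnIn hω hz₂y
  have hP₂box : ∀ w ∈ P₂.support, (n : ℤ) ≤ w 0 ∧ w 0 ≤ 3 * n ∧ 0 ≤ w 1 ∧ w 1 ≤ n := by
    intro w hw
    have h := hP₂S w hw
    rw [mem_inter_iff, hmemBig, mem_setOf_eq] at h
    omega
  -- the arm from `(2n,0)`
  obtain ⟨b₂, hb₂, t₂, ht₂, hbt₂⟩ := hA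
  rw [image_vshift_singleton, mem_singleton_iff] at hb₂
  rw [mem_image_add_topSide] at ht₂
  simp only [vshift_zero, vshift_one, zero_add] at ht₂
  push_cast at ht₂
  obtain ⟨Q₂, hQ₂S, hQ₂ω⟩ := exists_walk_of_mem_openConnIn hω hbt₂
  have hQ₂box : ∀ w ∈ Q₂.support, (n : ℤ) ≤ w 0 ∧ w 0 ≤ 3 * n ∧ 0 ≤ w 1 ∧ w 1 ≤ n := by
    intro w hw
    have h := hQ₂S w hw
    rw [mem_image_add_rectangle] at h
    simp only [vshift_zero, vshift_one] at h
    push_cast at h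
    omega
  have hb₂1 : b₂ 1 = 0 := by rw [hb₂]; rfl
  obtain ⟨w₂, hw₂P, hw₂Q⟩ := exists_mem_support_of_crossing (L := (n : ℤ)) (R := 3 * n) (B := 0) (T := n)
    P₂ Q₂ hP₂box hQ₂box hz₂0 (by rw [hy.2]) hb₂1 ht₂.2
  -- assemble `b₁ ↔ w₁ ↔ x ↔ y ↔ z₂ ↔ w₂ ↔ b₂` inside the half-plane
  have c₁ : ω ∈ openConnIn halfPlane b₁ w₁ :=
    openConnIn_mono hSqH _ _ (mem_openConnIn_of_mem_support Q₁ hQ₁S hQ₁ω hw₁Q)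
  have c₂ : ω ∈ openConnIn halfPlane w₁ x := by
    rw [openConnIn_comm]
    exact openConnIn_mono (inter_subset_left.trans hBigH) _ _
      (mem_openConnIn_of_mem_support P₁ hP₁S hP₁ω hw₁P)
  have c₃ : ω ∈ openConnIn halfPlane x y := openConnIn_mono hBigH _ _ hxy
  have c₄ : ω ∈ openConnIn halfPlane y z₂ :=
    openConnIn_mono (inter_subset_left.trans hBigH) _ _ hyz₂
  have c₅ : ω ∈ openConnIn halfPlane z₂ w₂ :=
    openConnIn_mono (inter_subset_left.trans hBigH) _ _
      (mem_openConnIn_of_mem_support P₂ hP₂S hP₂ω hw₂P)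
  have c₆ : ω ∈ openConnIn halfPlane w₂ b₂ := by
    rw [openConnIn_comm]
    exact openConnIn_mono hArH _ _ (mem_openConnIn_of_mem_support Q₂ hQ₂S hQ₂ω hw₂Q)
  refine ⟨b₁, ?_, b₂, by rw [hb₂]; exact mem_singleton _, ?_⟩
  · simp only [arcA, zero_mul, Int.floor_zero, one_mul, Int.floor_natCast, mem_setOf_eq]
    exact ⟨hb₁.2, hb₁.1.1, hb₁.1.2.1⟩
  · exact PlanarDuality.openConnIn_trans (PlanarDuality.openConnIn_trans
      (PlanarDuality.openConnIn_trans (PlanarDuality.openConnIn_trans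
        (PlanarDuality.openConnIn_trans c₁ c₂) c₃) c₄) c₅) c₆

/-- **§7 main**: at `x = c` (instance `0,1,2`), `n·P[E_n] = n·P[A_n ↔ (2n,0) in ℤ×ℕ] ≥ c_RSW/8`
for all `n ≥ 1`. [folklore] -/
theorem first_site_heavy : ∃ κ : ℝ, 0 < κ ∧ ∀ n : ℕ, 1 ≤ n → κ ≤ (n : ℝ) * μ.real (markEvent 0 1 2 2 n) := by
  obtain ⟨c, hc, hcross⟩ := rsw_lowerBound_holds 4 (by norm_num)
  refine ⟨c / 8, by positivity, fun n hn ↦ ?_⟩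
  set V := tbCrossing n n with hVdef
  set Hc := lrCrossing (3 * n) n with hHcdef
  set Ar := armEventAt (2 * (n : ℤ)) n with hArdef
  have hV : 1 / 2 ≤ μ.real V := by
    have h := real_tbCrossing half n n
    rw [show bondPercolation (zdGraph 2) half = μ from rfl] at h
    rw [hVdef, h]; exact half_le_crossingProb_self crossingProb_half_succ_self_holds n
  have hHc : c ≤ μ.real Hc := by
    have h1 := hcross (n + 1) (by omega)
    have h2 : crossingProb half (4 * (n + 1) - 1) (n + 1 - 1) ≤ crossingProb half (3 * n) n := by
      rw [show n + 1 - 1 = n by omega]; exact crossingProb_anti_left half (by omega) n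
    exact h1.trans h2
  have hAr : 1 / (2 * ((n : ℝ) + 1)) ≤ μ.real Ar := by
    rw [hArdef, measureReal_armEventAt]; exact armEvent_prob_ge n
  have hupV : IsUpperSet V := isUpperSet_openCrossing _ _ _
  have hupH : IsUpperSet Hc := isUpperSet_openCrossing _ _ _
  have hupA : IsUpperSet Ar := isUpperSet_openCrossing _ _ _
  have hmV : MeasurableSet V := measurableSet_openCrossing_of_countable _ _ _
  have hmH : MeasurableSet Hc := measurableSet_openCrossing_of_countable _ _ _
  have hmA : MeasurableSet Ar := measurableSet_openCrossing_of_countable _ _ _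
  have hfkg1 : μ.real V * μ.real Hc ≤ μ.real (V ∩ Hc) :=
    harris_fkg_holds (zdGraph 2) half hupV hupH hmV hmH
  have hfkg2 : μ.real (V ∩ Hc) * μ.real Ar ≤ μ.real (V ∩ Hc ∩ Ar) :=
    harris_fkg_holds (zdGraph 2) half (hupV.inter hupH) hupA (hmV.inter hmH) hmA
  have hincl : μ.real (V ∩ Hc ∩ Ar) ≤ μ.real (markEvent 0 1 2 2 n) := by
    rw [measureReal_def, measureReal_def]
    refine ENNReal.toReal_mono (measure_ne_top _ _) (measure_mono_ae ?_)
    filter_upwards [ae_subset_edgeSet (zdGraph 2) half] with ω hω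
    rintro ⟨⟨h1, h2⟩, h3⟩
    rw [markEvent_two]
    exact glue_to_point hω h1 h2 h3
  have hV0 : 0 ≤ μ.real V := measureReal_nonneg
  have hA0 : 0 ≤ μ.real Ar := measureReal_nonneg
  have hprod : 1 / 2 * c * (1 / (2 * ((n : ℝ) + 1))) ≤ μ.real (markEvent 0 1 2 2 n) :=
    calc 1 / 2 * c * (1 / (2 * ((n : ℝ) + 1))) ≤ μ.real V * μ.real Hc * μ.real Ar := by gcongr
      _ ≤ μ.real (V ∩ Hc) * μ.real Ar := by gcongr
      _ ≤ μ.real (V ∩ Hc ∩ Ar) := hfkg2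
      _ ≤ μ.real (markEvent 0 1 2 2 n) := hincl
  have hn1 : (1 : ℝ) ≤ n := by exact_mod_cast hn
  calc c / 8 ≤ (n : ℝ) * (1 / 2 * c * (1 / (2 * ((n : ℝ) + 1)))) := by
        rw [show (n : ℝ) * (1 / 2 * c * (1 / (2 * ((n : ℝ) + 1)))) = c * n / (4 * (n + 1)) by
          field_simp; ring]
        rw [div_le_div_iff₀ (by norm_num) (by positivity)]
        nlinarith
    _ ≤ (n : ℝ) * μ.real (markEvent 0 1 2 2 n) := by gcongr

/-- The claimed density at `x = c` is the junk value `0`. [folklore] -/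
lemma density_x_eq_c (a b c : ℝ) : density a b c c = 0 := by
  simp [density, Real.zero_rpow]

/-- **Corollary**: the crux's conclusion fails at the boundary `x = c` (instance `0,1,2,2`):
`n·P[E_n] ≥ κ > 0` cannot tend to `density 0 1 2 2 = 0`. [folklore] -/
theorem not_lawAt_x_eq_c : ¬ Tendsto (lawSeq 0 1 2 2) atTop (𝓝 (density 0 1 2 2)) := by
  intro h
  obtain ⟨κ, hκ, hlow⟩ := first_site_heavy
  rw [density_x_eq_c] at h
  have hev : ∀ᶠ n : ℕ in atTop, lawSeq 0 1 2 2 n < κ := h.eventually (gt_mem_nhds hκ)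
  obtain ⟨N, hN1, hN2⟩ := ((eventually_ge_atTop 1).and hev).exists
  exact absurd (hlow N hN1) (not_le.2 hN2)

/-- The crux with `c < x` weakened to `c ≤ x` is false for a SUBSTANTIVE reason (§7), not only
through the junk witness of §4. [folklore] -/
theorem law_false_with_hcx_le :
    ¬ ∀ a b c x : ℝ, a < b → b < c → c ≤ x → Tendsto (lawSeq a b c x) atTop (𝓝 (density a b c x)) :=
  fun h ↦ not_lawAt_x_eq_c (h 0 1 2 2 (by norm_num) (by norm_num) le_rfl)


/-! ## §9 For provers: beyond the half-plane Cardy CDF, RATIO REGULARITY of the mark events suffices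

The converse companion of §3 (a template, not a claim about percolation): IF the lattice CDF
`G_n(y) = P[A_n ↔ [⌊cn⌋,⌊yn⌋]×{0}]` converges to `F(η(a,b,c,y))` for `y ≥ x` (half-plane Cardy for two
arcs, pointwise) AND the mark events are ratio-regular at `x` (for every `ε` there is a window `δn` to
the right of `⌊xn⌋` on which `|P[E(k)] − P[E(⌊xn⌋)]| ≤ ε·P[E(⌊xn⌋)]` eventually), THEN the crux's
conclusion holds at `(a,b,c,x)` (`lawSeq_tendsto_of_cdf_of_ratioRegular`).  Proof: the window sum of
`P[E(k)]` is EXACTLY `G_n(x+δ') − G_n(x)` (§2), it is within `(1±ε)·M_n·P[E(⌊xn⌋)]` with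
`M_n/n → δ'`, and `(F(η(x+δ')) − F(η(x)))/δ' → density` (§1).  So what the route must add to
half-plane Cardy is precisely a GPS-type ratio-limit statement for the boundary two-arm event; by §5 it
is a statement about moving the marks by `O(δ)`. -/

/-- Real telescoping over a window: `G(k₁+m) = G(k₁) + Σ_{i<m} P[E(k₁+1+i)]` for `k₀ ≤ k₁ + 1`. [folklore] -/
theorem measureReal_crossing_window (S A : Set (Site 2)) {k₀ k₁ : ℤ} (hk : k₀ ≤ k₁ + 1) (m : ℕ) :
    μ.real (openCrossing S A (rowIcc k₀ (k₁ + m))) =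
      μ.real (openCrossing S A (rowIcc k₀ k₁)) +
        ∑ i ∈ Finset.range m, μ.real (firstHit S A k₀ (k₁ + 1 + i)) := by
  induction m with
  | zero => simp
  | succ m ih =>
    rw [Finset.sum_range_succ, ← add_assoc, ← ih,
      measureReal_firstHit_eq_sub S A (k := k₁ + 1 + m) (by omega)]
    push_cast
    ring_nf

/-- `(⌊(x+δ)n⌋ − ⌊xn⌋)/n → δ`. [folklore] -/
lemma tendsto_floor_window_div {x δ : ℝ} (hδ : 0 ≤ δ) :
    Tendsto (fun n : ℕ ↦ ((⌊(x + δ) * n⌋ - ⌊x * n⌋ : ℤ) : ℝ) / n) atTop (𝓝 δ) := by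
  have hlow : ∀ᶠ n : ℕ in atTop, δ - 1 / (n : ℝ) ≤ ((⌊(x + δ) * n⌋ - ⌊x * n⌋ : ℤ) : ℝ) / n := by
    filter_upwards [eventually_gt_atTop 0] with n hn
    have hn' : (0 : ℝ) < n := by exact_mod_cast hn
    rw [le_div_iff₀ hn', show (δ - 1 / (n : ℝ)) * n = δ * n - 1 by field_simp]
    have h1 := Int.lt_floor_add_one ((x + δ) * n)
    have h2 := Int.floor_le (x * n)
    push_cast
    nlinarith
  have hup : ∀ᶠ n : ℕ in atTop, ((⌊(x + δ) * n⌋ - ⌊x * n⌋ : ℤ) : ℝ) / n ≤ δ + 1 / (n : ℝ) := by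
    filter_upwards [eventually_gt_atTop 0] with n hn
    have hn' : (0 : ℝ) < n := by exact_mod_cast hn
    rw [div_le_iff₀ hn', show (δ + 1 / (n : ℝ)) * n = δ * n + 1 by field_simp]
    have h1 := Int.floor_le ((x + δ) * n)
    have h2 := Int.lt_floor_add_one (x * n)
    push_cast
    nlinarith
  have h0 : Tendsto (fun n : ℕ ↦ 1 / (n : ℝ)) atTop (𝓝 0) := tendsto_one_div_atTop_nhds_zero_nat
  refine tendsto_of_tendsto_of_tendsto_of_le_of_le' ?_ ?_ hlow hup
  · simpa using tendsto_const_nhds.sub h0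
  · simpa using tendsto_const_nhds.add h0

/-- **§9 main (template)**: half-plane Cardy CDF for `y ≥ x` + ratio regularity of the mark events at
`x` ⇒ the crux's conclusion at `(a,b,c,x)`. [folklore] -/
theorem lawSeq_tendsto_of_cdf_of_ratioRegular {a b c x : ℝ} (hab : a < b) (hbc : b < c) (hcx : c < x)
    (hcdf : ∀ y : ℝ, x ≤ y → Tendsto
      (fun n : ℕ ↦ μ.real (openCrossing halfPlane (arcA a b n) (rowIcc ⌊c * n⌋ ⌊y * n⌋))) atTop
      (𝓝 (𝔽 (crossRatio ![a, b, c, y]))))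
    (hratio : ∀ ε : ℝ, 0 < ε → ∃ δ : ℝ, 0 < δ ∧ ∀ᶠ n : ℕ in atTop, ∀ k : ℤ, ⌊x * n⌋ ≤ k →
      k ≤ ⌊(x + δ) * n⌋ → |μ.real (firstHit halfPlane (arcA a b n) ⌊c * n⌋ k) -
        μ.real (markEvent a b c x n)| ≤ ε * μ.real (markEvent a b c x n)) :
    Tendsto (lawSeq a b c x) atTop (𝓝 (density a b c x)) := by
  set d := density a b c x with hd
  have hdpos : 0 < d := density_pos hab hbc hcx
  set g : ℝ → ℝ := fun y ↦ 𝔽 (crossRatio ![a, b, c, y]) with hg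
  have hderiv : HasDerivAt g d x := hasDerivAt_cardy_crossRatio hab hbc hcx
  have hslope : Tendsto (fun t : ℝ ↦ t⁻¹ * (g (x + t) - g x)) (𝓝[>] 0) (𝓝 d) := by
    simpa only [smul_eq_mul] using hderiv.tendsto_slope_zero_right
  rw [Metric.tendsto_atTop]
  intro τ hτ
  -- choice of ε
  set ε : ℝ := min (1 / 2) (τ / (6 * (d + τ) + 6)) with hε
  have hε0 : 0 < ε := by rw [hε]; positivity
  have hε1 : ε ≤ 1 / 2 := min_le_left _ _
  have hε2 : ε ≤ τ / (6 * (d + τ) + 6) := min_le_right _ _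
  have hε3 : ε * (6 * (d + τ) + 6) ≤ τ := by rwa [le_div_iff₀ (by positivity)] at hε2
  have hεd : ε * (d + τ) ≤ τ / 6 := by nlinarith [hε3, hε0.le, hdpos.le, hτ.le]
  obtain ⟨δ, hδ, hwin⟩ := hratio ε hε0
  -- choice of δ' ∈ (0, δ] with slope within τ/3 of d
  have hsl : ∀ᶠ t : ℝ in 𝓝[>] 0, |t⁻¹ * (g (x + t) - g x) - d| < τ / 3 := by
    have := (Metric.tendsto_nhds.1 hslope) (τ / 3) (by positivity)
    simpa only [Real.dist_eq] using this
  have hI : ∀ᶠ t : ℝ in 𝓝[>] 0, t ∈ Ioc (0 : ℝ) δ := Ioc_mem_nhdsGT hδ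
  obtain ⟨δ', ⟨hδ'0, hδ'δ⟩, hδ'sl⟩ := (hI.and hsl).exists
  have hδ'0le : 0 ≤ δ' := hδ'0.le
  rw [abs_sub_lt_iff] at hδ'sl
  have hq1 : δ'⁻¹ * (g (x + δ') - g x) < d + τ / 3 := by linarith [hδ'sl.1]
  have hq2 : d - τ / 3 < δ'⁻¹ * (g (x + δ') - g x) := by linarith [hδ'sl.2]
  have hΔ : g (x + δ') - g x = δ' * (δ'⁻¹ * (g (x + δ') - g x)) := by field_simp
  have hΔup : g (x + δ') - g x < δ' * (d + τ / 3) := by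
    rw [hΔ]; exact mul_lt_mul_of_pos_left hq1 hδ'0
  have hΔdn : δ' * (d - τ / 3) < g (x + δ') - g x := by
    rw [hΔ]; exact mul_lt_mul_of_pos_left hq2 hδ'0
  have hs1 : d + τ / 3 ≤ (d + τ) * (1 - ε) := by nlinarith [hεd, hε0.le, hτ.le, hdpos.le]
  have hs2 : (d - τ) * (1 + ε) ≤ d - τ / 3 := by nlinarith [hεd, hε0.le, hτ.le, hdpos.le]
  have hval_up : (g (x + δ') - g x) / ((1 - ε) * δ') < d + τ := by
    rw [div_lt_iff₀ (mul_pos (by linarith) hδ'0)]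
    calc g (x + δ') - g x < δ' * (d + τ / 3) := hΔup
      _ ≤ δ' * ((d + τ) * (1 - ε)) := mul_le_mul_of_nonneg_left hs1 hδ'0le
      _ = (d + τ) * ((1 - ε) * δ') := by ring
  have hval_dn : d - τ < (g (x + δ') - g x) / ((1 + ε) * δ') := by
    rw [lt_div_iff₀ (mul_pos (by linarith) hδ'0)]
    calc (d - τ) * ((1 + ε) * δ') = δ' * ((d - τ) * (1 + ε)) := by ring
      _ ≤ δ' * (d - τ / 3) := mul_le_mul_of_nonneg_left hs2 hδ'0le
      _ < g (x + δ') - g x := hΔdn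
  -- the window data
  set M : ℕ → ℕ := fun n ↦ (⌊(x + δ') * n⌋ - ⌊x * n⌋).toNat with hM
  have hMint : ∀ n : ℕ, ((M n : ℕ) : ℤ) = ⌊(x + δ') * n⌋ - ⌊x * n⌋ := by
    intro n; rw [hM, Int.toNat_of_nonneg]
    exact sub_nonneg.2 (Int.floor_le_floor (by nlinarith [Nat.cast_nonneg (α := ℝ) n]))
  have hMlim : Tendsto (fun n : ℕ ↦ (M n : ℝ) / n) atTop (𝓝 δ') := by
    refine (tendsto_floor_window_div (x := x) hδ'0le).congr fun n ↦ ?_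
    rw [← hMint n, Int.cast_natCast]
  set Sm : ℕ → ℝ := fun n ↦ ∑ i ∈ Finset.range (M n),
    μ.real (firstHit halfPlane (arcA a b n) ⌊c * n⌋ (⌊x * n⌋ + 1 + i)) with hSm
  have hSG : ∀ n : ℕ, Sm n = μ.real (openCrossing halfPlane (arcA a b n) (rowIcc ⌊c * n⌋ ⌊(x + δ') * n⌋)) -
      μ.real (openCrossing halfPlane (arcA a b n) (rowIcc ⌊c * n⌋ ⌊x * n⌋)) := by
    intro n
    have hk : ⌊c * (n : ℝ)⌋ ≤ ⌊x * (n : ℝ)⌋ + 1 := by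
      have := Int.floor_le_floor (mul_le_mul_of_nonneg_right hcx.le (Nat.cast_nonneg n)); omega
    have h := measureReal_crossing_window halfPlane (arcA a b n) hk (M n)
    rw [hMint, show ⌊x * (n : ℝ)⌋ + (⌊(x + δ') * n⌋ - ⌊x * n⌋) = ⌊(x + δ') * n⌋ by ring] at h
    simp only [hSm]
    linarith
  have hSlim : Tendsto Sm atTop (𝓝 (g (x + δ') - g x)) := by
    refine ((hcdf (x + δ') (by linarith)).sub (hcdf x le_rfl)).congr fun n ↦ ?_
    rw [hSG n]
  have hq_up : Tendsto (fun n : ℕ ↦ Sm n / ((1 - ε) * ((M n : ℝ) / n))) atTop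
      (𝓝 ((g (x + δ') - g x) / ((1 - ε) * δ'))) :=
    hSlim.div (tendsto_const_nhds.mul hMlim) (mul_ne_zero (by linarith) hδ'0.ne')
  have hq_dn : Tendsto (fun n : ℕ ↦ Sm n / ((1 + ε) * ((M n : ℝ) / n))) atTop
      (𝓝 ((g (x + δ') - g x) / ((1 + ε) * δ'))) :=
    hSlim.div (tendsto_const_nhds.mul hMlim) (mul_ne_zero (by linarith) hδ'0.ne')
  have hMpos : ∀ᶠ n : ℕ in atTop, δ' / 2 < (M n : ℝ) / n :=
    hMlim.eventually (lt_mem_nhds (by linarith))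
  have h_up := hq_up.eventually (gt_mem_nhds hval_up)
  have h_dn := hq_dn.eventually (lt_mem_nhds hval_dn)
  obtain ⟨N, hN⟩ := eventually_atTop.1
    ((((h_up.and h_dn).and hMpos).and hwin).and (eventually_gt_atTop 0))
  refine ⟨N, fun n hn ↦ ?_⟩
  obtain ⟨⟨⟨⟨hup, hdn⟩, hMp⟩, hw⟩, hn0⟩ := hN n hn
  have hn' : (0 : ℝ) < n := by exact_mod_cast hn0
  set p := μ.real (markEvent a b c x n) with hp
  have hp0 : 0 ≤ p := measureReal_nonneg
  have hm0 : 0 < (M n : ℝ) := by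
    have h := mul_pos (by linarith : (0 : ℝ) < (M n : ℝ) / n) hn'
    rwa [div_mul_cancel₀ _ hn'.ne'] at h
  -- term bounds from ratio regularity
  have hterm : ∀ i ∈ Finset.range (M n),
      (1 - ε) * p ≤ μ.real (firstHit halfPlane (arcA a b n) ⌊c * n⌋ (⌊x * n⌋ + 1 + i)) ∧
        μ.real (firstHit halfPlane (arcA a b n) ⌊c * n⌋ (⌊x * n⌋ + 1 + i)) ≤ (1 + ε) * p := by
    intro i hi
    rw [Finset.mem_range] at hi
    have hk2 : ⌊x * (n : ℝ)⌋ + 1 + i ≤ ⌊(x + δ) * n⌋ := by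
      have h1 : ((i : ℕ) : ℤ) + 1 ≤ ((M n : ℕ) : ℤ) := by exact_mod_cast hi
      have h2 : ⌊(x + δ') * (n : ℝ)⌋ ≤ ⌊(x + δ) * n⌋ := Int.floor_le_floor (by nlinarith [hn'.le])
      rw [hMint] at h1
      omega
    have h := hw (⌊x * n⌋ + 1 + i) (by omega) hk2
    rw [abs_le] at h
    constructor <;> linarith [h.1, h.2]
  have hsum_lo : (M n : ℝ) * ((1 - ε) * p) ≤ Sm n := by
    have h := Finset.sum_le_sum fun i hi ↦ (hterm i hi).1
    simpa only [Finset.sum_const, Finset.card_range, nsmul_eq_mul, hSm] using h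
  have hsum_hi : Sm n ≤ (M n : ℝ) * ((1 + ε) * p) := by
    have h := Finset.sum_le_sum fun i hi ↦ (hterm i hi).2
    simpa only [Finset.sum_const, Finset.card_range, nsmul_eq_mul, hSm] using h
  -- conclude
  rw [Real.dist_eq, abs_sub_lt_iff]
  have hlaw : lawSeq a b c x n = (n : ℝ) * p := rfl
  have hpos1 : 0 < (1 - ε) * ((M n : ℝ) / n) := mul_pos (by linarith) (div_pos hm0 hn')
  have hpos2 : 0 < (1 + ε) * ((M n : ℝ) / n) := mul_pos (by linarith) (div_pos hm0 hn')
  constructor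
  · have h1 : (n : ℝ) * p ≤ Sm n / ((1 - ε) * ((M n : ℝ) / n)) := by
      rw [le_div_iff₀ hpos1]
      calc (n : ℝ) * p * ((1 - ε) * ((M n : ℝ) / n)) = (M n : ℝ) * ((1 - ε) * p) := by
            field_simp
        _ ≤ Sm n := hsum_lo
    rw [hlaw]; linarith [hup]
  · have h1 : Sm n / ((1 + ε) * ((M n : ℝ) / n)) ≤ (n : ℝ) * p := by
      rw [div_le_iff₀ hpos2]
      calc Sm n ≤ (M n : ℝ) * ((1 + ε) * p) := hsum_hi
        _ = (n : ℝ) * p * ((1 + ε) * ((M n : ℝ) / n)) := by field_simp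
    rw [hlaw]; linarith [hdn]

/-! ## §8 Numerics and the printed negative (no Lean content)

**Printed ¬Cardy claim.**  The one negative result in print bearing on the crux is Zhang,
arXiv:2206.04599 (2022, 113 pp., unrefereed), Cor. 2 p. 6: "Cardy's formula does not hold for site and
bond percolation on `ℤ²_δ`".  If correct it would refute the crux through §3.  Its mechanism (pp. 5–6,
materialised `lit read arxiv:2206.04599`): a claimed Smirnov-type LINEAR crossing formula for site
percolation on an AFFINELY STRETCHED lattice (`δ`-parallelograms, his Theorem/Cor. 1), transported to
`ℤ²` by a non-conformal stretch + rotation (eqs. (1.2.12)–(1.2.15)).  A sheared embedding of a critical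
lattice has a sheared conformal structure (barrier `Literature.Barriers.CriticalPhenomena.
EmbeddingModulusUniqueness`; DKLM 2026 Thm 11 for the six-vertex height function: anisotropic weights
are needed to compensate a shear), so the linear formula cannot hold for both the stretched and the
unstretched embedding; the claim also contradicts three decades of crossing numerics on bond-`ℤ²`
(Ziff 1992 ff.; search-degraded this session: searchd rc 75, to be page-cited on re-arm).  Our MC below
tests the half-plane crossing CDF on `ℤ×ℕ` directly.

**MC (kit job j013796, 4 cores, 113 s wall; script `mc_markdensity.py` in the seat folder; evidence `compute-j013796.json`
attached to the item by the compute daemon; earlier ids j007812 = smoke that exposed a summary bug, j007859/j013753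
cancelled as mis-sized; the larger run j013799 — n = 32/64/128 with 150k/40k/4k samples — is still queued at this
attach and lands on the item automatically).**  Model: bond-`ℤ²` at `p = 1/2` on `ℤ×ℕ` truncated to the box
`[−8n,8n]×[0,8n]` (free sides), marks `a,b,c = −1.5,−0.5,0.5` (units of `n`), per sample the `c`-most vertex
`K ≥ ⌊cn⌋` joined to `A_n` inside the box; estimator `n·P̂[K = k]` in windows of `x = k/n`, compared with (i) the
crux's `density` (half-plane, raw marks) and (ii) the exact continuum prediction for the BOX with half-site mark
conventions (Schwarz–Christoffel `g(u) = sn(K u/8 | 1/2)`, `φ_box = F'(η(g(a),g(b),g(c),g(x)))·∂ₓη → density` as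
the box grows; `φ_box/density ≈ 0.93–0.97` on `x ∈ (0.5,4)`).
RESULTS (n = 32: 39 984 samples; n = 64: 6 000 samples):
* `n·P̂/φ_box`, inverse-variance mean over 13 windows `x ∈ [0.55,4)`: **0.974 ± 0.010 (n=32), 0.983 ± 0.025
  (n=64)**; per-window ratios scatter in `0.90–1.06` (n=32, ±3–5 % each) and `0.80–1.11` (n=64, ±5–11 %);
  `χ²/dof` vs `φ_box`: 2.2 (n=32: residual `O(1/n)` convention effects), 0.64 (n=64).  Against the raw half-plane
  `density`: 0.89 / 0.92 (the 8n-box truncation, computed exactly, accounts for it).  Sample rows (n=32):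
  `x∈[1,1.2)`: `n·P̂ = 0.1285(38)`, `φ_box = 0.1263`, `density = 0.1321`; `x∈[2,2.5)`: `0.0329(13)`, `0.0320`,
  `0.0354`; (n=64) `x∈[1,1.2)`: `0.1313(104)`, `0.1271`, `0.1319`.
* CDF `P̂[A_n ↔ [⌊cn⌋,⌊4n⌋−1]]` = 0.4527 (n=32), 0.4410 (n=64) vs `F(η_box) = 0.4404, 0.4367` and half-plane
  `F(η) = 0.4466`: offset +0.012 → +0.004, shrinking with `n` (first-site convention, see next item).
* First site (the excluded `x = c`): `P[K = ⌊cn⌋] = 0.1666 (n=32), 0.1245 (n=64)`, i.e. `n^{1/3}·P = 0.53, 0.50`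
  — the conjectured `n^{−1/3}` half-plane one-arm scaling of §7's anomaly; next sites `n·P = 0.96, 0.73, 0.58, …`
  (n=32) decay into the density profile.
* Lattice-scale smoothness: `χ²/dof` of `counts[j]` against the local average `(counts[j−1]+counts[j+1])/2`,
  `j ∈ [n/8, 2n]`: **1.06 (n=32, 5 %/site resolution), 0.73 (n=64)** — no oscillation.  (The even/odd offset sums,
  0.90 and 0.85, are NOT an oscillation: for a decreasing profile `Σ_odd − Σ_even ≈ counts[1]/2`, predicting 0.89
  and 0.91.)
VERDICT of §8: at `n ≤ 64` the lattice density agrees with the crux's law (finite-box-corrected) to 2–3 %, the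
deviation shrinks with `n`, the profile is smooth at lattice scale, and the first site carries the `n^{−1/3}`
anomaly exactly as §7 predicts.  No numerical evidence against the crux; none against half-plane Cardy on `ℤ²`.
-/


/-! ## Targets (the lead's stuck stubs)

None at generation 1 (payload `targets = []`, `stuck_stubs = []`: no line picked, no skeleton registered).
On re-arm the stubs of the picked line are attacked here, statements copied verbatim. -/

end Summit.CriticalPhenomena.CardyFormulaZ2.Cruxes.HalfPlaneMarkDensityLaw.Disproof
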